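import Mathlib.Analysis.Convex.Jensen
import Literature.MathematicalPhysics.QuantumLattice.TIGroundEnergyDensityResponse
import Literature.MathematicalPhysics.QuantumLattice.HubbardTTPrimeEnergyDensityVariationalPrinciple
import Literature.MathematicalPhysics.QuantumLattice.HubbardTTPrimeMeanEnergySupergradient
import Literature.MathematicalPhysics.QuantumLattice.InfVolFermionStateMixture
import Literature.Computation.Certificates.BoxCoveringByCells
import HarnessLib

/-!
# Multi-parameter coupling families of lattice-fermion interactions: the variational ground-state
# energy density over a state class is JOINTLY concave in the coupling vector — corner (Jensen)
# floors, box ⇒ word, joint Lipschitz bounds, the multi-slope tangent plane, the cross-variational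
# inequality, transport of minimisers as approximate minimisers; the density-constrained density
# and its Legendre link; the `t–t'` Hubbard bridge

Topic `Literature/MathematicalPhysics/QuantumLattice` (family `hubbard`, model-free part general `d`);
namespace `Literature.MathematicalPhysics.QuantumLattice` (the file path). The MULTI-PARAMETER companion
of `TIGroundEnergyDensityResponse.lean` (ONE-parameter pencils `Ψ₀ + s·Ψ₁`, the grand-canonical-type
object `FermionInteraction.tiGroundEnergyDensity Ψ R = inf {e_Ψ(ω) : ω translation invariant}`, the
Griffiths brackets) and of the `t–t'–U`-specific coupling calculus of the tree
(`HubbardTTPrimeMeanEnergySupergradient`, `HubbardNNNHoppingEnergyDensityConcave`,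
`HubbardTTPrimeGrandCanonicalEnergyDensity`, `HubbardTTPrimeChemicalPotentialFloors`, `…BoxTransport`).
Written for stage S2 CERTIFIER-FAMILIES of the Hubbard material-oracle programme (D-0096 (ii) «model →
phase: families of models, t′, multi-band»; D-0097 «points → parameter BOXES»): a downfolded material
arrives as a BOX in a coupling vector `θ = (t, t', t'', U, V, J, μ, h, …)` of an effective lattice
Hamiltonian `H(θ) = H₀ + Σ_a θ_a H_a`, and the transport rules by which words certified at finitely many
couplings cover the box must not be re-proved for every new coordinate. Here they are proved ONCE, for

* an arbitrary finite LINEAR FAMILY of interactions `Ψ(θ) = Ψ₀ + Σ_a θ_a Ψ_a` on `ℤ^d`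
  (`FermionInteraction.linearFamily`, §1; every coordinate line is a pencil, `linearFamily_add_single`,
  so the one-parameter response brackets of the companion file apply coordinate-wise), and
* the variational ground-state energy density over an ARBITRARY class `S` of infinite-volume states,
  `FermionInteraction.infMeanEnergyOn S Ψ R = inf {e_Ψ(ω) : ω ∈ S}` (§2): `S` = translation-invariant
  states gives `tiGroundEnergyDensity` (`tiGroundEnergyDensity_eq_infMeanEnergyOn`, by `rfl`),
  `S` = translation-invariant states of density `ρ` gives the CANONICAL object
  `FermionInteraction.tiGroundEnergyDensityAt Ψ R ρ` (§9), and symmetry-restricted classes (even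
  states, fixed magnetisation, …) are covered by the same theorems.

Results (everything PROVED; the three definitions have bodies; no named fact, no number, no `sorry`):

* §3 JOINT CONCAVITY `concaveOn_infMeanEnergyOn_linearFamily` (`θ ↦ inf_{ω∈S} e_{Ψ(θ)}(ω)` is concave
  on the whole coupling space — an infimum of affine functions; Israel 1979 Thm. I.3.4 for the pressure,
  Ruelle 1969 §3.4, Koma–Tasaki 1994 §1), hence the BARYCENTRIC / JENSEN FLOOR
  `sum_mul_le_infMeanEnergyOn_linearFamily` (floors `cᵢ` certified at anchors `θᵢ` give
  `Σ wᵢcᵢ` at `Σ wᵢθᵢ`), the HULL FLOOR `le_infMeanEnergyOn_linearFamily_of_mem_convexHull`, and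
  BOX ⇒ WORD `le_infMeanEnergyOn_linearFamily_of_mem_Icc` (a floor certified at the `2^|ι|` vertices of
  a coordinate box holds on the box; weights from `BoxCoveringByCells.exists_convexWeights_boxVertices`).
* §4 JOINT LIPSCHITZ bounds `abs_infMeanEnergyOn_linearFamily_sub_le` (`Σ_a C_a |θ_a − θ'_a|` with any
  class constants `|e_{Ψ_a}(ω)| ≤ C_a` on `S` — e.g. the kinematic `16/π²` hopping constants at fixed
  density) and `…_sub_le_norm` (`C_a = ‖E_{Ψ_a}‖`, Israel's `|P(Φ) − P(Ψ)| ≤ ‖Φ − Ψ‖`).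
* §5 the MULTI-SLOPE TANGENT PLANE at a class minimiser `ω₀` of `Ψ(θ₀)`:
  `e(θ) ≤ e(θ₀) + Σ_a (θ_a − θ₀_a) e_{Ψ_a}(ω₀)` (`infMeanEnergyOn_linearFamily_le_tangent`; Griffiths
  1966 §II / Koma–Tasaki 1994 §1: the conjugate densities are a supergradient), its trial-state form and
  the CERTIFIED form with slope windows `e_{Ψ_a}(ω₀) ∈ [lo_a, hi_a]`
  (`infMeanEnergyOn_linearFamily_le_of_slopes_mem_Icc`, sign-split `max((θ_a−θ₀_a)lo_a, (θ_a−θ₀_a)hi_a)`).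
* §6 the CROSS-VARIATIONAL inequality for two class minimisers
  `Σ_a (θ_a − θ'_a)(e_{Ψ_a}(ω) − e_{Ψ_a}(ω')) ≤ 0` (`sum_sub_mul_sub_meanEnergy_nonpos`) and its coordinate
  corollary: a conjugate density is antitone in its own coupling with all other couplings held fixed
  (`meanEnergy_anti_coordinate`).
* §7 TRANSPORT OF MINIMISERS: a class minimiser `ω` at `θ` is an approximate minimiser of the ANCHOR
  interaction `Ψ(θ₀)`, `e_{Ψ(θ₀)}(ω) ≤ e(θ₀) + Σ_a (θ_a − θ₀_a)(e_{Ψ_a}(ω₀) − e_{Ψ_a}(ω))`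
  (`meanEnergy_anchor_le_of_isMinOn`), priced by bracket widths
  (`meanEnergy_anchor_le_of_isMinOn_of_mem_Icc`: `≤ e(θ₀) + Σ_a |θ_a − θ₀_a|(hi_a − lo_a)`) — the hook by
  which an energy-window relaxation issued at ONE anchor (Wang et al. 2024 §III) constrains the minimisers
  of every coupling in a box.
* §8 monotonicity in a coordinate whose conjugate density is signed on `S`
  (`infMeanEnergyOn_linearFamily_mono_coordinate`; e.g. `U ↦ e` is non-decreasing because `docc ≥ 0`).
* §9 the DENSITY-CONSTRAINED density `tiGroundEnergyDensityAt Ψ R ρ`: variational API, CONVEXITY IN `ρ`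
  (`tiGroundEnergyDensityAt_convex_comb_le`, `convexOn_tiGroundEnergyDensityAt`; mixtures,
  `InfVolFermionStateMixture.density_mix`), `e₀ ≤ e_ρ`, and the LEGENDRE LINK with the `μ`-pencil of
  the companion file: `e₀(Ψ − μn) + μρ ≤ e_ρ(Ψ)` for every realised density and
  `e₀(Ψ − μn) = inf_ρ (e_ρ(Ψ) − μρ)` (`isGLB_tiGroundEnergyDensity_sub_mul`) — the model-free form of the
  `μ`-floor ⇔ grand-potential dictionary of `HubbardTTPrimeChemicalPotentialFloors` /
  `…GrandCanonicalEnergyDensity`.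
* §10 the `t–t'` HUBBARD BRIDGE: `Φ(t,t',U)` IS the linear family with directions
  `Φ(1,0,0), Φ(0,1,0), Φ(0,0,1)` (`hubbardTTPrimeFermionInteraction_eq_linearFamily`), and for `U ≥ 0`,
  `0 < ρ < 2` the density-constrained density IS Ruelle's thermodynamic limit:
  `tiGroundEnergyDensityAt Φ(t,t',U) 1 ρ = energyDensityTT' t t' U ρ`
  (`tiGroundEnergyDensityAt_hubbardTTPrime_eq_energyDensityTT'`, from the tree's variational principle
  `isLeast_meanEnergy_energyDensityTT'`), so every theorem above specialises to the certified `t–t'–U`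
  words, and extends them verbatim to any added coupling (`t''`, `V`, `J`, Zeeman `h`, sources).

HONEST SCOPE: transport / convexity lemmas only — no number, no certificate, no claim about any ground
state; `infMeanEnergyOn ∅ Ψ R = 0` by the `sInf ∅` convention (statements that need a realised class
carry `S.Nonempty`); no thermodynamic-limit identification beyond the two bridges quoted
(`TorusGroundEnergyDensityLimit` for the translation-invariant class, `isLeast_meanEnergy_energyDensityTT'`
for the `t–t'` density classes); positive temperature is the finite-volume layer
`GibbsFreeEnergyCouplingConcavity` (coordinate families of matrices), not this file.

## Mathlib / tree search

Mathlib: `ConcaveOn.le_map_sum`, `ConcaveOn.exists_le_of_mem_convexHull`, `ConcaveOn.subset`,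
`Real.sInf_empty`, `csInf_le`, `le_csInf`, `exists_lt_of_csInf_lt`, `IsLeast.csInf_eq`, `isMinOn_iff`.
Tree (REUSED, not restated): `FermionInteraction.pencil`, `tiGroundEnergyDensity`, `numberInteraction`,
`InfVolFermionState.meanEnergy_pencil`, `abs_meanEnergy_le_norm`, `meanEnergy_numberInteraction`
(`TIGroundEnergyDensityResponse`); `density_mix`, `meanEnergy_mix`, `IsTranslationInvariant.mix`
(`InfVolFermionState[Mixture]`); `hubbardTTPrimeFermionInteraction_add/_smul`
(`HubbardTTPrimeMeanEnergySupergradient`); `isLeast_meanEnergy_energyDensityTT'`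
(`HubbardTTPrimeEnergyDensityVariationalPrinciple`); `exists_convexWeights_boxVertices`
(`BoxCoveringByCells`). `lean search 'linearFamily|infMeanEnergyOn|tiGroundEnergyDensityAt'`: no hits;
`lean search 'concaveOn_tiGroundEnergyDensity'`: the one-parameter pencil and the sourced pencil only.

## References

* R. B. Israel, *Convexity in the Theory of Lattice Gases*, Princeton 1979, Thm. I.3.4 (the pressure
  is convex and `1`-Lipschitz in the interaction). [cite: Israel1979, Thm. I.3.4]
* D. Ruelle, *Statistical Mechanics: Rigorous Results* (1969), §3.4. [cite: Ruelle1969, §3.4]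
* O. Bratteli, A. Kishimoto, D. W. Robinson, Commun. Math. Phys. 64 (1978) 41–48, §3 and Thm. 2
  (mean energy of translation-invariant states; its minimisers). [cite: BratteliKishimotoRobinson1978, Thm. 2]
* R. B. Griffiths, Phys. Rev. 152 (1966) 240, §II–III (one-sided derivatives of a concave
  thermodynamic function bound the conjugate variable). [cite: Griffiths1966, §II]
* T. Koma, H. Tasaki, J. Stat. Phys. 76 (1994) 745, §1 (energies concave in linear couplings;
  conjugate observables). [cite: KomaTasaki1994, §1]
* J. Wang et al., PRX 14 (2024) 031006, §III (observable bounds for all states under an energy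
  constraint). [cite: WangEtAl2024, §III]
* R. T. Rockafellar, *Convex Analysis* (1970), Thm. 32.2 (extrema of concave functions over polytopes
  are attained at vertices). [cite: Rockafellar1970, Thm 32.2]
-/

noncomputable section

namespace Literature.MathematicalPhysics.QuantumLattice

open Matrix Finset HubbardWave0 Literature.Probability.LatticeModels ThermodynamicLimit
open Literature.Computation.Certificates
open scoped ComplexOrder BigOperators

variable {d : ℕ} {ι : Type*} [Fintype ι]

/-! ### §1. Linear families of interactions `Ψ(θ) = Ψ₀ + Σ_a θ_a Ψ_a` -/

namespace FermionInteraction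

/-- Two interactions with the same local terms are equal (an interaction IS its family of local terms
`X ↦ Φ(X)`). [cite: ArakiMoriya2003, §5.1] -/
theorem ext {Ψ₁ Ψ₂ : FermionInteraction d} (h : ∀ X, Ψ₁.Φ X = Ψ₂.Φ X) : Ψ₁ = Ψ₂ := by
  cases Ψ₁; cases Ψ₂
  simp only [FermionInteraction.mk.injEq]
  exact funext h

/-- **The linear family `Ψ(θ) = Ψ₀ + Σ_a θ_a Ψ_a` of interactions** spanned by finitely many
directions `Ψ_a` around a base interaction `Ψ₀` (termwise `Φ X = Φ₀ X + Σ_a θ_a • Φ_a X`): the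
coupling-vector parametrisation of a family of effective lattice Hamiltonians
`H(θ) = H₀ + Σ_a θ_a H_a` (hoppings, interactions, fields, sources). Koma–Tasaki (1994) §1;
Israel (1979) §I.3 (the pressure as a function on the Banach space of interactions).
[cite: KomaTasaki1994, §1] -/
def linearFamily (Ψ₀ : FermionInteraction d) (Ψ : ι → FermionInteraction d) (θ : ι → ℝ) :
    FermionInteraction d where
  Φ X := Ψ₀.Φ X + ∑ a, ((θ a : ℝ) : ℂ) • (Ψ a).Φ X

variable (Ψ₀ : FermionInteraction d) (Ψ : ι → FermionInteraction d) (θ : ι → ℝ)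

/-- The terms of the linear family (definitional). [cite: KomaTasaki1994, §1] -/
theorem linearFamily_apply (X : Finset (Site d)) :
    (linearFamily Ψ₀ Ψ θ).Φ X = Ψ₀.Φ X + ∑ a, ((θ a : ℝ) : ℂ) • (Ψ a).Φ X := rfl

/-- At `θ = 0` the family is the base interaction. [cite: KomaTasaki1994, §1] -/
theorem linearFamily_zero : linearFamily Ψ₀ Ψ 0 = Ψ₀ :=
  ext fun X => by simp [linearFamily_apply]

/-- **Coordinate lines of a linear family are pencils**: `Ψ(θ + s e_a) = Ψ(θ) + s Ψ_a` — so the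
one-parameter response brackets of `TIGroundEnergyDensityResponse` apply along every coordinate.
[cite: KomaTasaki1994, §1] -/
theorem linearFamily_add_single [DecidableEq ι] (a : ι) (s : ℝ) :
    linearFamily Ψ₀ Ψ (θ + Pi.single a s) = pencil (linearFamily Ψ₀ Ψ θ) (Ψ a) s := by
  refine ext fun X => ?_
  simp only [linearFamily_apply, pencil_apply, Pi.add_apply, Complex.ofReal_add, add_smul,
    Finset.sum_add_distrib, Pi.single_apply, apply_ite Complex.ofReal, Complex.ofReal_zero, ite_smul,
    zero_smul, Finset.sum_ite_eq', Finset.mem_univ, if_true, add_assoc]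

/-- A linear family of even interactions is even. [cite: ArakiMoriya2003, §1 assumption (II)] -/
theorem isEven_linearFamily {Ψ₀ : FermionInteraction d} {Ψ : ι → FermionInteraction d}
    (h₀ : Ψ₀.IsEven) (h : ∀ a, (Ψ a).IsEven) (θ : ι → ℝ) : (linearFamily Ψ₀ Ψ θ).IsEven := fun X => by
  rw [linearFamily_apply, map_add, map_sum, h₀ X]
  exact congrArg _ (Finset.sum_congr rfl fun a _ => by rw [map_smul, h a X])

/-- A real linear family of Hermitian interactions is Hermitian. [cite: ArakiMoriya2003, §1 assumption (II)] -/
theorem isHermitian_linearFamily {Ψ₀ : FermionInteraction d} {Ψ : ι → FermionInteraction d}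
    (h₀ : Ψ₀.IsHermitian) (h : ∀ a, (Ψ a).IsHermitian) (θ : ι → ℝ) :
    (linearFamily Ψ₀ Ψ θ).IsHermitian := fun X => by
  unfold Matrix.IsHermitian
  rw [linearFamily_apply, Matrix.conjTranspose_add, Matrix.conjTranspose_sum, (h₀ X).eq]
  exact congrArg _ (Finset.sum_congr rfl fun a _ => by
    rw [Matrix.conjTranspose_smul, (h a X).eq, Complex.star_def, Complex.conj_ofReal])

/-- A linear family of interactions of range `R` has range `R`. [cite: ArakiMoriya2003, §5.4] -/
theorem hasFiniteRange_linearFamily {Ψ₀ : FermionInteraction d} {Ψ : ι → FermionInteraction d} {R : ℝ}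
    (h₀ : Ψ₀.HasFiniteRange R) (h : ∀ a, (Ψ a).HasFiniteRange R) (θ : ι → ℝ) :
    (linearFamily Ψ₀ Ψ θ).HasFiniteRange R := fun X hX => by
  rw [linearFamily_apply, h₀ X hX, zero_add]
  exact Finset.sum_eq_zero fun a _ => by rw [h a X hX, smul_zero]

/-- A linear family of translation-covariant interactions is translation covariant.
[cite: ArakiMoriya2003, §1 assumption (IV)] -/
theorem isTranslationInvariant_linearFamily {Ψ₀ : FermionInteraction d} {Ψ : ι → FermionInteraction d}
    (h₀ : Ψ₀.IsTranslationInvariant) (h : ∀ a, (Ψ a).IsTranslationInvariant) (θ : ι → ℝ) :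
    (linearFamily Ψ₀ Ψ θ).IsTranslationInvariant := fun v X => by
  rw [linearFamily_apply, linearFamily_apply, h₀ v X, map_add, map_sum]
  exact congrArg _ (Finset.sum_congr rfl fun a _ => by rw [h a v X, map_smul])

/-- **The local Hamiltonians of the family are `H₀ + Σ_a θ_a H_a`.** [cite: KomaTasaki1994, §1] -/
theorem localHamiltonian_linearFamily (Λ : Finset (Site d)) :
    (linearFamily Ψ₀ Ψ θ).localHamiltonian Λ =
      Ψ₀.localHamiltonian Λ + ∑ a, ((θ a : ℝ) : ℂ) • (Ψ a).localHamiltonian Λ := by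
  unfold localHamiltonian
  simp only [linearFamily_apply, map_add, map_sum, map_smul, Finset.sum_add_distrib, Finset.smul_sum]
  rw [Finset.sum_comm]

/-- **The mean-energy observable of the family is `E_{Ψ₀} + Σ_a θ_a E_{Ψ_a}`.**
[cite: BratteliKishimotoRobinson1978, §3 (mean energy functional)] -/
theorem meanEnergyObs_linearFamily (R : ℝ) :
    (linearFamily Ψ₀ Ψ θ).meanEnergyObs R =
      Ψ₀.meanEnergyObs R + ∑ a, ((θ a : ℝ) : ℂ) • (Ψ a).meanEnergyObs R := by
  unfold meanEnergyObs
  simp only [linearFamily_apply, map_add, map_sum, map_smul, smul_add, Finset.smul_sum,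
    Finset.sum_add_distrib]
  rw [Finset.sum_comm]
  exact congrArg _ (Finset.sum_congr rfl fun a _ => Finset.sum_congr rfl fun X _ => smul_comm _ _ _)

end FermionInteraction

namespace InfVolFermionState

variable (ω : InfVolFermionState d) (Ψ₀ : FermionInteraction d) (Ψ : ι → FermionInteraction d)

/-- **The mean energy is affine along a linear family**:
`e_{Ψ(θ)}(ω) = e_{Ψ₀}(ω) + Σ_a θ_a e_{Ψ_a}(ω)` for every infinite-volume state `ω`; the slopes
`e_{Ψ_a}(ω)` are the CONJUGATE DENSITIES of the couplings in the state `ω` (double occupancy for `U`,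
hopping energies for `t, t'`, density for `−μ`, magnetisation for a field, …).
[cite: BratteliKishimotoRobinson1978, §3 (mean energy functional)] -/
theorem meanEnergy_linearFamily (θ : ι → ℝ) (R : ℝ) :
    ω.meanEnergy (FermionInteraction.linearFamily Ψ₀ Ψ θ) R =
      ω.meanEnergy Ψ₀ R + ∑ a, θ a * ω.meanEnergy (Ψ a) R := by
  unfold InfVolFermionState.meanEnergy
  rw [FermionInteraction.meanEnergyObs_linearFamily, map_add, map_sum, Complex.add_re, Complex.re_sum]
  exact congrArg _ (Finset.sum_congr rfl fun a _ => by
    rw [map_smul, smul_eq_mul, Complex.re_ofReal_mul])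

/-- **Moving the coupling vector**: `e_{Ψ(θ)}(ω) = e_{Ψ(θ')}(ω) + Σ_a (θ_a − θ'_a) e_{Ψ_a}(ω)` — the
first-order Taylor formula is exact because the family is affine. [cite: KomaTasaki1994, §1] -/
theorem meanEnergy_linearFamily_eq_add_sum_sub_mul (θ θ' : ι → ℝ) (R : ℝ) :
    ω.meanEnergy (FermionInteraction.linearFamily Ψ₀ Ψ θ) R =
      ω.meanEnergy (FermionInteraction.linearFamily Ψ₀ Ψ θ') R +
        ∑ a, (θ a - θ' a) * ω.meanEnergy (Ψ a) R := by
  rw [meanEnergy_linearFamily, meanEnergy_linearFamily, add_assoc, ← Finset.sum_add_distrib]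
  exact congrArg _ (Finset.sum_congr rfl fun a _ => by ring)

end InfVolFermionState

/-! ### §2. The variational ground-state energy density over a state class -/

namespace FermionInteraction

/-- **The variational ground-state energy density of `Ψ` over a class `S` of states**:
`inf { e_Ψ(ω) : ω ∈ S }` (mean energy at range parameter `R`). For `S` the translation-invariant
states this is `tiGroundEnergyDensity` (`tiGroundEnergyDensity_eq_infMeanEnergyOn`); for the
translation-invariant states of density `ρ` it is the canonical density `tiGroundEnergyDensityAt`
(§9); symmetry-restricted classes are allowed. By the real `sInf` convention the value is `0` on an
empty or unbounded-below class (the latter never occurs: `|e_Ψ(ω)| ≤ ‖E_Ψ‖`).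
[cite: BratteliKishimotoRobinson1978, Thm. 2 (condition 2)] -/
def infMeanEnergyOn (S : Set (InfVolFermionState d)) (Ψ : FermionInteraction d) (R : ℝ) : ℝ :=
  sInf ((fun ω : InfVolFermionState d => ω.meanEnergy Ψ R) '' S)

variable (S : Set (InfVolFermionState d)) (Ψ₁ : FermionInteraction d) (R : ℝ)

/-- `tiGroundEnergyDensity` is the variational density over the translation-invariant class
(definitional). [cite: BratteliKishimotoRobinson1978, Thm. 2 (condition 2)] -/
theorem tiGroundEnergyDensity_eq_infMeanEnergyOn :
    Ψ₁.tiGroundEnergyDensity R =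
      infMeanEnergyOn {ω : InfVolFermionState d | ω.IsTranslationInvariant} Ψ₁ R := rfl

/-- The empty class gives `0` (the real `sInf ∅` convention; recorded so that class-generic statements
need no non-emptiness hypothesis where it is immaterial). [cite: BratteliKishimotoRobinson1978, Thm. 2 (condition 2)] -/
theorem infMeanEnergyOn_empty : infMeanEnergyOn ∅ Ψ₁ R = 0 := by
  rw [infMeanEnergyOn, Set.image_empty, Real.sInf_empty]

open scoped Matrix.Norms.L2Operator in
/-- The mean energies over any class are bounded below (by `−‖E_Ψ‖`). [cite: BratteliRobinsonI1987, Prop. 2.3.11] -/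
theorem bddBelow_meanEnergy_image_on :
    BddBelow ((fun ω : InfVolFermionState d => ω.meanEnergy Ψ₁ R) '' S) := by
  refine ⟨-‖Ψ₁.meanEnergyObs R‖, ?_⟩
  rintro _ ⟨ω, -, rfl⟩
  exact (abs_le.1 (ω.abs_meanEnergy_le_norm Ψ₁ R)).1

variable {S}

/-- **Variational upper bound**: `inf_S e_Ψ ≤ e_Ψ(ω)` for every `ω ∈ S`.
[cite: BratteliKishimotoRobinson1978, Thm. 2 (condition 2)] -/
theorem infMeanEnergyOn_le_meanEnergy {ω : InfVolFermionState d} (hω : ω ∈ S) :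
    infMeanEnergyOn S Ψ₁ R ≤ ω.meanEnergy Ψ₁ R :=
  csInf_le (bddBelow_meanEnergy_image_on S Ψ₁ R) (Set.mem_image_of_mem _ hω)

/-- **Greatest lower bound**: a number below `e_Ψ(ω)` for every `ω` of a non-empty class is
`≤ inf_S e_Ψ` — the shape in which a lower bound certified for every state of the class is read.
[cite: BratteliKishimotoRobinson1978, Thm. 2 (condition 2)] -/
theorem le_infMeanEnergyOn (hS : S.Nonempty) {c : ℝ} (h : ∀ ω ∈ S, c ≤ ω.meanEnergy Ψ₁ R) :
    c ≤ infMeanEnergyOn S Ψ₁ R :=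
  le_csInf (hS.image _) (by
    rintro _ ⟨ω, hω, rfl⟩
    exact h ω hω)

/-- `c ≤ inf_S e_Ψ` iff `c ≤ e_Ψ(ω)` for all `ω ∈ S` (non-empty class). [cite: BratteliKishimotoRobinson1978, Thm. 2 (condition 2)] -/
theorem le_infMeanEnergyOn_iff (hS : S.Nonempty) {c : ℝ} :
    c ≤ infMeanEnergyOn S Ψ₁ R ↔ ∀ ω ∈ S, c ≤ ω.meanEnergy Ψ₁ R :=
  ⟨fun h _ hω => h.trans (infMeanEnergyOn_le_meanEnergy Ψ₁ R hω), le_infMeanEnergyOn Ψ₁ R hS⟩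

/-- If `inf_S e_Ψ < c` (non-empty class) some `ω ∈ S` has `e_Ψ(ω) < c`. [cite: BratteliKishimotoRobinson1978, Thm. 2 (condition 2)] -/
theorem exists_meanEnergy_lt_of_infMeanEnergyOn_lt (hS : S.Nonempty) {c : ℝ}
    (h : infMeanEnergyOn S Ψ₁ R < c) : ∃ ω ∈ S, ω.meanEnergy Ψ₁ R < c := by
  obtain ⟨_, ⟨ω, hω, rfl⟩, hlt⟩ := exists_lt_of_csInf_lt (hS.image _) h
  exact ⟨ω, hω, hlt⟩

/-- **Smaller classes have larger infima**: `S ⊆ T`, `S ≠ ∅` ⇒ `inf_T e_Ψ ≤ inf_S e_Ψ` (restricting the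
variational class can only raise the variational energy). [cite: BratteliKishimotoRobinson1978, Thm. 2 (condition 2)] -/
theorem infMeanEnergyOn_anti (hS : S.Nonempty) {T : Set (InfVolFermionState d)} (hST : S ⊆ T) :
    infMeanEnergyOn T Ψ₁ R ≤ infMeanEnergyOn S Ψ₁ R :=
  le_infMeanEnergyOn Ψ₁ R hS fun _ hω => infMeanEnergyOn_le_meanEnergy Ψ₁ R (hST hω)

open scoped Matrix.Norms.L2Operator in
/-- `|inf_S e_Ψ| ≤ ‖E_Ψ‖` (non-empty class). [cite: BratteliRobinsonI1987, Prop. 2.3.11] -/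
theorem abs_infMeanEnergyOn_le_norm (hS : S.Nonempty) : |infMeanEnergyOn S Ψ₁ R| ≤ ‖Ψ₁.meanEnergyObs R‖ := by
  obtain ⟨ω, hω⟩ := hS
  refine abs_le.2 ⟨le_infMeanEnergyOn Ψ₁ R ⟨ω, hω⟩ fun ω' _ =>
    (abs_le.1 (ω'.abs_meanEnergy_le_norm Ψ₁ R)).1, ?_⟩
  exact (infMeanEnergyOn_le_meanEnergy Ψ₁ R hω).trans (abs_le.1 (ω.abs_meanEnergy_le_norm Ψ₁ R)).2

/-- **Class minimisers attain the infimum**: `ω ∈ S` minimises `e_Ψ` on `S` iff `e_Ψ(ω) ≤ inf_S e_Ψ`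
(hence `=`). [cite: BratteliKishimotoRobinson1978, Thm. 2 (condition 2)] -/
theorem isMinOn_meanEnergy_iff {ω : InfVolFermionState d} (hω : ω ∈ S) :
    IsMinOn (fun ω' : InfVolFermionState d => ω'.meanEnergy Ψ₁ R) S ω ↔
      ω.meanEnergy Ψ₁ R ≤ infMeanEnergyOn S Ψ₁ R := by
  rw [isMinOn_iff]
  exact ⟨fun h => le_infMeanEnergyOn Ψ₁ R ⟨ω, hω⟩ h,
    fun h ω' hω' => h.trans (infMeanEnergyOn_le_meanEnergy Ψ₁ R hω')⟩

/-- The mean energy of a class minimiser is the class infimum. [cite: BratteliKishimotoRobinson1978, Thm. 2 (condition 2)] -/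
theorem meanEnergy_eq_infMeanEnergyOn_of_isMinOn {ω : InfVolFermionState d} (hω : ω ∈ S)
    (hmin : IsMinOn (fun ω' : InfVolFermionState d => ω'.meanEnergy Ψ₁ R) S ω) :
    ω.meanEnergy Ψ₁ R = infMeanEnergyOn S Ψ₁ R :=
  le_antisymm ((isMinOn_meanEnergy_iff Ψ₁ R hω).1 hmin) (infMeanEnergyOn_le_meanEnergy Ψ₁ R hω)

end FermionInteraction

/-! ### §3. Joint concavity in the coupling vector; corner floors; box ⇒ word -/

namespace FermionInteraction

variable (S : Set (InfVolFermionState d)) (Ψ₀ : FermionInteraction d) (Ψ : ι → FermionInteraction d)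
  (R : ℝ)

/-- **JOINT CONCAVITY.** For every class `S` of states, `θ ↦ inf_{ω ∈ S} e_{Ψ₀ + Σθ_aΨ_a}(ω)` is
concave on the whole coupling space `ι → ℝ` (an infimum of the affine functions
`θ ↦ e_{Ψ₀}(ω) + Σ_a θ_a e_{Ψ_a}(ω)`; the empty class gives the constant `0`). Israel (1979) Thm. I.3.4
(the pressure is convex in the interaction), Ruelle (1969) §3.4, Koma–Tasaki (1994) §1 (ground-state
energies are concave in linear couplings). [cite: Israel1979, Thm. I.3.4] -/
theorem concaveOn_infMeanEnergyOn_linearFamily :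
    ConcaveOn ℝ Set.univ fun θ : ι → ℝ => infMeanEnergyOn S (linearFamily Ψ₀ Ψ θ) R := by
  refine ⟨convex_univ, fun x _ y _ a b ha hb hab => ?_⟩
  rcases S.eq_empty_or_nonempty with rfl | hS
  · simp only [infMeanEnergyOn_empty, smul_zero, add_zero, le_refl]
  refine le_infMeanEnergyOn _ R hS fun ω hω => ?_
  have hx := infMeanEnergyOn_le_meanEnergy (linearFamily Ψ₀ Ψ x) R hω
  have hy := infMeanEnergyOn_le_meanEnergy (linearFamily Ψ₀ Ψ y) R hω
  rw [ω.meanEnergy_linearFamily] at hx hy ⊢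
  simp only [smul_eq_mul, Pi.add_apply, Pi.smul_apply]
  have hsum : ∑ c, (a * x c + b * y c) * ω.meanEnergy (Ψ c) R =
      a * ∑ c, x c * ω.meanEnergy (Ψ c) R + b * ∑ c, y c * ω.meanEnergy (Ψ c) R := by
    rw [Finset.mul_sum, Finset.mul_sum, ← Finset.sum_add_distrib]
    exact Finset.sum_congr rfl fun c _ => by ring
  have key : ω.meanEnergy Ψ₀ R + ∑ c, (a * x c + b * y c) * ω.meanEnergy (Ψ c) R =
      a * (ω.meanEnergy Ψ₀ R + ∑ c, x c * ω.meanEnergy (Ψ c) R) +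
        b * (ω.meanEnergy Ψ₀ R + ∑ c, y c * ω.meanEnergy (Ψ c) R) := by
    rw [hsum]; linear_combination (-ω.meanEnergy Ψ₀ R) * hab
  rw [key]
  exact add_le_add (mul_le_mul_of_nonneg_left hx ha) (mul_le_mul_of_nonneg_left hy hb)

/-- **BARYCENTRIC (JENSEN) FLOOR — transport of corner floors to the hull.** Floors `cᵢ ≤ e(θᵢ)`
certified at finitely many anchors `θᵢ` and weights `wᵢ ≥ 0`, `Σ wᵢ = 1`, give
`Σ wᵢ cᵢ ≤ e(Σ wᵢ θᵢ)` (`e(θ) = inf_S e_{Ψ(θ)}`): a word certified at the corners of a cell holds,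
with the barycentric combination of the corner constants, at every point of the cell.
[cite: Israel1979, Thm. I.3.4] -/
theorem sum_mul_le_infMeanEnergyOn_linearFamily {κ : Type*} (s : Finset κ) (w : κ → ℝ)
    (hw0 : ∀ i ∈ s, 0 ≤ w i) (hw1 : ∑ i ∈ s, w i = 1) (θ : κ → ι → ℝ) (c : κ → ℝ)
    (hc : ∀ i ∈ s, c i ≤ infMeanEnergyOn S (linearFamily Ψ₀ Ψ (θ i)) R) :
    ∑ i ∈ s, w i * c i ≤ infMeanEnergyOn S (linearFamily Ψ₀ Ψ (∑ i ∈ s, w i • θ i)) R := by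
  have hJ := (concaveOn_infMeanEnergyOn_linearFamily S Ψ₀ Ψ R).le_map_sum hw0 hw1
    (fun i _ => Set.mem_univ (θ i))
  refine le_trans (Finset.sum_le_sum fun i hi => ?_) hJ
  rw [smul_eq_mul]
  exact mul_le_mul_of_nonneg_left (hc i hi) (hw0 i hi)

/-- **Uniform corner floor ⇒ floor at the barycentre**: `m ≤ e(θᵢ)` for all anchors ⇒ `m ≤ e(Σ wᵢθᵢ)`.
[cite: Israel1979, Thm. I.3.4] -/
theorem le_infMeanEnergyOn_linearFamily_sum_smul {κ : Type*} (s : Finset κ) (w : κ → ℝ)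
    (hw0 : ∀ i ∈ s, 0 ≤ w i) (hw1 : ∑ i ∈ s, w i = 1) (θ : κ → ι → ℝ) {m : ℝ}
    (hm : ∀ i ∈ s, m ≤ infMeanEnergyOn S (linearFamily Ψ₀ Ψ (θ i)) R) :
    m ≤ infMeanEnergyOn S (linearFamily Ψ₀ Ψ (∑ i ∈ s, w i • θ i)) R := by
  have h := sum_mul_le_infMeanEnergyOn_linearFamily S Ψ₀ Ψ R s w hw0 hw1 θ (fun _ => m) hm
  rwa [← Finset.sum_mul, hw1, one_mul] at h

/-- **HULL FLOOR**: a floor valid at every point of a set `T` of couplings is valid on its convex hull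
(the minimum of a concave function over a polytope is attained at a vertex, Rockafellar Thm. 32.2).
[cite: Rockafellar1970, Thm 32.2] -/
theorem le_infMeanEnergyOn_linearFamily_of_mem_convexHull {T : Set (ι → ℝ)} {m : ℝ}
    (hm : ∀ θ' ∈ T, m ≤ infMeanEnergyOn S (linearFamily Ψ₀ Ψ θ') R) {θ : ι → ℝ}
    (hθ : θ ∈ convexHull ℝ T) : m ≤ infMeanEnergyOn S (linearFamily Ψ₀ Ψ θ) R := by
  obtain ⟨y, hy, hle⟩ :=
    (concaveOn_infMeanEnergyOn_linearFamily S Ψ₀ Ψ R).exists_le_of_mem_convexHull (Set.subset_univ T) hθ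
  exact (hm y hy).trans hle

/-- **BOX ⇒ WORD.** A floor `m` certified at the `2^|ι|` VERTICES of a coordinate box
`[lo, hi] ⊆ (ι → ℝ)` (the vertex set `Fintype.piFinset fun a => {lo a, hi a}`) holds at every coupling
vector of the box. [cite: Rockafellar1970, Thm 32.2] -/
theorem le_infMeanEnergyOn_linearFamily_of_mem_Icc [DecidableEq ι] (lo hi : ι → ℝ) {m : ℝ}
    (hm : ∀ v ∈ Fintype.piFinset (fun a => ({lo a, hi a} : Finset ℝ)),
      m ≤ infMeanEnergyOn S (linearFamily Ψ₀ Ψ v) R)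
    {θ : ι → ℝ} (hθ : θ ∈ Set.Icc lo hi) : m ≤ infMeanEnergyOn S (linearFamily Ψ₀ Ψ θ) R := by
  obtain ⟨w, hw0, hw1, hsum⟩ := BoxCovering.exists_convexWeights_boxVertices lo hi hθ
  have h := le_infMeanEnergyOn_linearFamily_sum_smul S Ψ₀ Ψ R _ w hw0 hw1 (fun v => v) hm
  rwa [hsum] at h

end FermionInteraction

/-! ### §4. Joint Lipschitz bounds -/

namespace FermionInteraction

variable {S : Set (InfVolFermionState d)} (Ψ₀ : FermionInteraction d) (Ψ : ι → FermionInteraction d)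
  (R : ℝ)

/-- **One-sided Lipschitz step with class constants.** If `|e_{Ψ_a}(ω)| ≤ C_a` for every `ω ∈ S`
(non-empty), then `e(θ) ≤ e(θ') + Σ_a C_a |θ_a − θ'_a|` (`e(θ) = inf_S e_{Ψ(θ)}`). With the kinematic
constants of a fixed-density class (`16/π²` per unit hopping) this is the density-sharp transport loss;
with `C_a = ‖E_{Ψ_a}‖` it is Israel's norm bound. [cite: Israel1979, Thm. I.3.4] -/
theorem infMeanEnergyOn_linearFamily_le_add_sum (hS : S.Nonempty) {C : ι → ℝ}
    (hC : ∀ ω ∈ S, ∀ a, |ω.meanEnergy (Ψ a) R| ≤ C a) (θ θ' : ι → ℝ) :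
    infMeanEnergyOn S (linearFamily Ψ₀ Ψ θ) R ≤
      infMeanEnergyOn S (linearFamily Ψ₀ Ψ θ') R + ∑ a, C a * |θ a - θ' a| := by
  rw [← sub_le_iff_le_add]
  refine le_infMeanEnergyOn _ R hS fun ω hω => ?_
  rw [sub_le_iff_le_add]
  have h1 := infMeanEnergyOn_le_meanEnergy (linearFamily Ψ₀ Ψ θ) R hω
  rw [ω.meanEnergy_linearFamily_eq_add_sum_sub_mul Ψ₀ Ψ θ θ' R] at h1
  have h3 : ∑ a, (θ a - θ' a) * ω.meanEnergy (Ψ a) R ≤ ∑ a, C a * |θ a - θ' a| :=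
    Finset.sum_le_sum fun a _ => by
      calc (θ a - θ' a) * ω.meanEnergy (Ψ a) R ≤ |(θ a - θ' a) * ω.meanEnergy (Ψ a) R| := le_abs_self _
        _ = |θ a - θ' a| * |ω.meanEnergy (Ψ a) R| := abs_mul _ _
        _ ≤ |θ a - θ' a| * C a := mul_le_mul_of_nonneg_left (hC ω hω a) (abs_nonneg _)
        _ = C a * |θ a - θ' a| := mul_comm _ _
  linarith

/-- **JOINT LIPSCHITZ BOUND with class constants**: `|e(θ) − e(θ')| ≤ Σ_a C_a |θ_a − θ'_a|`.
[cite: Israel1979, Thm. I.3.4] -/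
theorem abs_infMeanEnergyOn_linearFamily_sub_le (hS : S.Nonempty) {C : ι → ℝ}
    (hC : ∀ ω ∈ S, ∀ a, |ω.meanEnergy (Ψ a) R| ≤ C a) (θ θ' : ι → ℝ) :
    |infMeanEnergyOn S (linearFamily Ψ₀ Ψ θ) R - infMeanEnergyOn S (linearFamily Ψ₀ Ψ θ') R| ≤
      ∑ a, C a * |θ a - θ' a| := by
  rw [abs_sub_le_iff]
  constructor
  · linarith [infMeanEnergyOn_linearFamily_le_add_sum Ψ₀ Ψ R hS hC θ θ']
  · have h := infMeanEnergyOn_linearFamily_le_add_sum Ψ₀ Ψ R hS hC θ' θ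
    have hs : ∑ a, C a * |θ' a - θ a| = ∑ a, C a * |θ a - θ' a| :=
      Finset.sum_congr rfl fun a _ => by rw [abs_sub_comm]
    linarith

open scoped Matrix.Norms.L2Operator in
/-- **JOINT LIPSCHITZ BOUND in the direction norms** (any class, Israel 1979 Thm. I.3.4
`|P(Φ) − P(Ψ)| ≤ ‖Φ − Ψ‖`): `|e(θ) − e(θ')| ≤ Σ_a ‖E_{Ψ_a}‖ |θ_a − θ'_a|`. [cite: Israel1979, Thm. I.3.4] -/
theorem abs_infMeanEnergyOn_linearFamily_sub_le_norm (S : Set (InfVolFermionState d)) (θ θ' : ι → ℝ) :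
    |infMeanEnergyOn S (linearFamily Ψ₀ Ψ θ) R - infMeanEnergyOn S (linearFamily Ψ₀ Ψ θ') R| ≤
      ∑ a, ‖(Ψ a).meanEnergyObs R‖ * |θ a - θ' a| := by
  rcases S.eq_empty_or_nonempty with rfl | hS
  · simp only [infMeanEnergyOn_empty, sub_self, abs_zero]
    exact Finset.sum_nonneg fun a _ => mul_nonneg (norm_nonneg _) (abs_nonneg _)
  exact abs_infMeanEnergyOn_linearFamily_sub_le Ψ₀ Ψ R hS
    (fun ω _ a => ω.abs_meanEnergy_le_norm (Ψ a) R) θ θ'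

end FermionInteraction

/-! ### §5. The multi-slope tangent plane (supergradient) -/

namespace FermionInteraction

variable {S : Set (InfVolFermionState d)} (Ψ₀ : FermionInteraction d) (Ψ : ι → FermionInteraction d)
  (R : ℝ)

/-- **Trial-state cap, transported**: for ANY state `ω₀ ∈ S`,
`e(θ) ≤ e_{Ψ(θ₀)}(ω₀) + Σ_a (θ_a − θ₀_a) e_{Ψ_a}(ω₀)` — a variational upper bound issued at `θ₀`
(e.g. a translation-invariant trial state) caps `e` at every `θ` through its own conjugate densities.
[cite: KomaTasaki1994, §1] -/
theorem infMeanEnergyOn_linearFamily_le_trial {ω₀ : InfVolFermionState d} (hω₀ : ω₀ ∈ S)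
    (θ₀ θ : ι → ℝ) :
    infMeanEnergyOn S (linearFamily Ψ₀ Ψ θ) R ≤
      ω₀.meanEnergy (linearFamily Ψ₀ Ψ θ₀) R + ∑ a, (θ a - θ₀ a) * ω₀.meanEnergy (Ψ a) R := by
  rw [← ω₀.meanEnergy_linearFamily_eq_add_sum_sub_mul Ψ₀ Ψ θ θ₀ R]
  exact infMeanEnergyOn_le_meanEnergy _ R hω₀

/-- **THE MULTI-SLOPE TANGENT PLANE.** If `ω₀ ∈ S` minimises `e_{Ψ(θ₀)}` on `S`, then for every
coupling vector `θ`: `e(θ) ≤ e(θ₀) + Σ_a (θ_a − θ₀_a) e_{Ψ_a}(ω₀)` — the vector of conjugate densities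
of a minimiser is a supergradient of the concave `e` at `θ₀` (Griffiths 1966 §II; Koma–Tasaki 1994 §1;
the `t–t'–U` instance is the tree's `IsTorusLimitOf.energyDensityTT'_le_affine`).
[cite: Griffiths1966, §II] -/
theorem infMeanEnergyOn_linearFamily_le_tangent {ω₀ : InfVolFermionState d} (hω₀ : ω₀ ∈ S)
    {θ₀ : ι → ℝ}
    (hmin : IsMinOn (fun ω : InfVolFermionState d => ω.meanEnergy (linearFamily Ψ₀ Ψ θ₀) R) S ω₀)
    (θ : ι → ℝ) :
    infMeanEnergyOn S (linearFamily Ψ₀ Ψ θ) R ≤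
      infMeanEnergyOn S (linearFamily Ψ₀ Ψ θ₀) R + ∑ a, (θ a - θ₀ a) * ω₀.meanEnergy (Ψ a) R := by
  rw [← meanEnergy_eq_infMeanEnergyOn_of_isMinOn _ R hω₀ hmin]
  exact infMeanEnergyOn_linearFamily_le_trial Ψ₀ Ψ R hω₀ θ₀ θ

/-- Sign-split product bound: `x ∈ [lo, hi]` ⇒ `δ·x ≤ max(δ·lo, δ·hi)` for every real `δ`. [folklore] -/
private theorem mul_le_max_mul_of_mem_Icc {δ x lo hi : ℝ} (hx : x ∈ Set.Icc lo hi) :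
    δ * x ≤ max (δ * lo) (δ * hi) := by
  rcases le_total 0 δ with hδ | hδ
  · exact (mul_le_mul_of_nonneg_left hx.2 hδ).trans (le_max_right _ _)
  · exact (mul_le_mul_of_nonpos_left hx.1 hδ).trans (le_max_left _ _)

/-- **CERTIFIED TANGENT CAP with slope windows.** A cap `e_{Ψ(θ₀)}(ω₀) ≤ u` for some `ω₀ ∈ S` (a
minimiser, for which `u` is a certified cap on `e(θ₀)`, or any trial state) and certified brackets
`e_{Ψ_a}(ω₀) ∈ [lo_a, hi_a]` on its conjugate densities give, at EVERY coupling vector `θ`,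
`e(θ) ≤ u + Σ_a max((θ_a − θ₀_a)·lo_a, (θ_a − θ₀_a)·hi_a)` — the multi-coupling form of the anchored
cap transport (`t–t'–U` instances: `HubbardTTPrimeUBoxWords`, `…DiagHopTransport`,
`GibbsFreeEnergyCouplingConcavity.freeEnergy_coord_le_of_slopes_mem_Icc` at `T > 0`).
[cite: Griffiths1966, §II] -/
theorem infMeanEnergyOn_linearFamily_le_of_slopes_mem_Icc {ω₀ : InfVolFermionState d} (hω₀ : ω₀ ∈ S)
    {θ₀ : ι → ℝ} {u : ℝ} (hu : ω₀.meanEnergy (linearFamily Ψ₀ Ψ θ₀) R ≤ u) {lo hi : ι → ℝ}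
    (hslope : ∀ a, ω₀.meanEnergy (Ψ a) R ∈ Set.Icc (lo a) (hi a)) (θ : ι → ℝ) :
    infMeanEnergyOn S (linearFamily Ψ₀ Ψ θ) R ≤
      u + ∑ a, max ((θ a - θ₀ a) * lo a) ((θ a - θ₀ a) * hi a) := by
  refine (infMeanEnergyOn_linearFamily_le_trial Ψ₀ Ψ R hω₀ θ₀ θ).trans (add_le_add hu ?_)
  exact Finset.sum_le_sum fun a _ => mul_le_max_mul_of_mem_Icc (hslope a)

end FermionInteraction

/-! ### §6. The cross-variational inequality and coordinate monotonicity of conjugate densities -/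

namespace InfVolFermionState

variable {S : Set (InfVolFermionState d)} (Ψ₀ : FermionInteraction d) (Ψ : ι → FermionInteraction d)
  (R : ℝ)

/-- **CROSS-VARIATIONAL INEQUALITY.** If `ω` minimises `e_{Ψ(θ)}` and `ω'` minimises `e_{Ψ(θ')}` on the
same class `S` (both members of `S`), then `Σ_a (θ_a − θ'_a)(e_{Ψ_a}(ω) − e_{Ψ_a}(ω')) ≤ 0`: add the
two variational inequalities `e_{Ψ(θ)}(ω) ≤ e_{Ψ(θ)}(ω')`, `e_{Ψ(θ')}(ω') ≤ e_{Ψ(θ')}(ω)` and use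
affinity (the `t–t'–U` ground-state instance is the tree's `directionalGC_le_of_cross_variational`;
Griffiths 1966 §II for the one-coupling case). [cite: Griffiths1966, §II] -/
theorem sum_sub_mul_sub_meanEnergy_nonpos {ω ω' : InfVolFermionState d} (hω : ω ∈ S) (hω' : ω' ∈ S)
    {θ θ' : ι → ℝ}
    (hmin : IsMinOn (fun σ : InfVolFermionState d => σ.meanEnergy (FermionInteraction.linearFamily Ψ₀ Ψ θ) R) S ω)
    (hmin' : IsMinOn (fun σ : InfVolFermionState d => σ.meanEnergy (FermionInteraction.linearFamily Ψ₀ Ψ θ') R) S ω') :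
    ∑ a, (θ a - θ' a) * (ω.meanEnergy (Ψ a) R - ω'.meanEnergy (Ψ a) R) ≤ 0 := by
  have h1 : ω.meanEnergy (FermionInteraction.linearFamily Ψ₀ Ψ θ) R ≤
      ω'.meanEnergy (FermionInteraction.linearFamily Ψ₀ Ψ θ) R := hmin hω'
  have h2 : ω'.meanEnergy (FermionInteraction.linearFamily Ψ₀ Ψ θ') R ≤
      ω.meanEnergy (FermionInteraction.linearFamily Ψ₀ Ψ θ') R := hmin' hω
  rw [ω.meanEnergy_linearFamily_eq_add_sum_sub_mul Ψ₀ Ψ θ θ' R,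
    ω'.meanEnergy_linearFamily_eq_add_sum_sub_mul Ψ₀ Ψ θ θ' R] at h1
  have hs : ∑ a, (θ a - θ' a) * (ω.meanEnergy (Ψ a) R - ω'.meanEnergy (Ψ a) R) =
      ∑ a, (θ a - θ' a) * ω.meanEnergy (Ψ a) R - ∑ a, (θ a - θ' a) * ω'.meanEnergy (Ψ a) R := by
    rw [← Finset.sum_sub_distrib]
    exact Finset.sum_congr rfl fun a _ => by ring
  rw [hs]
  linarith

/-- **A conjugate density is ANTITONE in its own coupling, all other couplings fixed**: if `θ` and
`θ'` agree off the coordinate `a` and `θ_a < θ'_a`, then for class minimisers `ω` at `θ`, `ω'` at `θ'`: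
`e_{Ψ_a}(ω') ≤ e_{Ψ_a}(ω)` (double occupancy non-increasing in `U`, hopping energies in `t'`, induced
order parameter non-decreasing in its source, density non-decreasing in `μ`).
[cite: Griffiths1966, §II] -/
theorem meanEnergy_anti_coordinate {ω ω' : InfVolFermionState d} (hω : ω ∈ S) (hω' : ω' ∈ S)
    {θ θ' : ι → ℝ} {a : ι} (hoff : ∀ b, b ≠ a → θ b = θ' b) (ha : θ a < θ' a)
    (hmin : IsMinOn (fun σ : InfVolFermionState d => σ.meanEnergy (FermionInteraction.linearFamily Ψ₀ Ψ θ) R) S ω)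
    (hmin' : IsMinOn (fun σ : InfVolFermionState d => σ.meanEnergy (FermionInteraction.linearFamily Ψ₀ Ψ θ') R) S ω') :
    ω'.meanEnergy (Ψ a) R ≤ ω.meanEnergy (Ψ a) R := by
  have h := sum_sub_mul_sub_meanEnergy_nonpos Ψ₀ Ψ R hω hω' hmin hmin'
  rw [Finset.sum_eq_single a (fun b _ hb => by rw [hoff b hb, sub_self, zero_mul])
    (fun h => absurd (Finset.mem_univ a) h)] at h
  have hneg : θ a - θ' a < 0 := sub_neg.2 ha
  nlinarith

end InfVolFermionState

/-! ### §7. Transport of minimisers: a minimiser at `θ` is an approximate minimiser of the anchor -/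

namespace InfVolFermionState

variable {S : Set (InfVolFermionState d)} (Ψ₀ : FermionInteraction d) (Ψ : ι → FermionInteraction d)
  (R : ℝ)

/-- **Anchor energy of a foreign minimiser (exact form).** If `ω` minimises `e_{Ψ(θ)}` over `S`
(`e_{Ψ(θ)}(ω) ≤ e_{Ψ(θ)}(σ)` for all `σ ∈ S`) and `ω₀ ∈ S` minimises `e_{Ψ(θ₀)}` on `S`, then
`e_{Ψ(θ₀)}(ω) ≤ e(θ₀) + Σ_a (θ_a − θ₀_a)(e_{Ψ_a}(ω₀) − e_{Ψ_a}(ω))`, `e(θ₀) = inf_S e_{Ψ(θ₀)}`: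
the minimisers of the couplings in a box are APPROXIMATE MINIMISERS of the anchor interaction, with an
explicit excess — so every bound an energy-window relaxation certifies for all states of `S` within that
excess of `e(θ₀)` (Wang et al. 2024 §III) holds for them. (`t'`-only, `T > 0` twin:
`HubbardTTPrimeDiagHopTransportThermal` §6.) [cite: WangEtAl2024, §III] -/
theorem meanEnergy_anchor_le_of_isMinOn {ω ω₀ : InfVolFermionState d} (hω₀ : ω₀ ∈ S)
    {θ θ₀ : ι → ℝ}
    (hmin : IsMinOn (fun σ : InfVolFermionState d => σ.meanEnergy (FermionInteraction.linearFamily Ψ₀ Ψ θ) R) S ω)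
    (hmin₀ : IsMinOn (fun σ : InfVolFermionState d => σ.meanEnergy (FermionInteraction.linearFamily Ψ₀ Ψ θ₀) R) S ω₀) :
    ω.meanEnergy (FermionInteraction.linearFamily Ψ₀ Ψ θ₀) R ≤
      FermionInteraction.infMeanEnergyOn S (FermionInteraction.linearFamily Ψ₀ Ψ θ₀) R +
        ∑ a, (θ a - θ₀ a) * (ω₀.meanEnergy (Ψ a) R - ω.meanEnergy (Ψ a) R) := by
  have h1 : ω.meanEnergy (FermionInteraction.linearFamily Ψ₀ Ψ θ) R ≤
      ω₀.meanEnergy (FermionInteraction.linearFamily Ψ₀ Ψ θ) R := hmin hω₀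
  rw [ω.meanEnergy_linearFamily_eq_add_sum_sub_mul Ψ₀ Ψ θ θ₀ R,
    ω₀.meanEnergy_linearFamily_eq_add_sum_sub_mul Ψ₀ Ψ θ θ₀ R,
    FermionInteraction.meanEnergy_eq_infMeanEnergyOn_of_isMinOn _ R hω₀ hmin₀] at h1
  have hs : ∑ a, (θ a - θ₀ a) * (ω₀.meanEnergy (Ψ a) R - ω.meanEnergy (Ψ a) R) =
      ∑ a, (θ a - θ₀ a) * ω₀.meanEnergy (Ψ a) R - ∑ a, (θ a - θ₀ a) * ω.meanEnergy (Ψ a) R := by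
    rw [← Finset.sum_sub_distrib]
    exact Finset.sum_congr rfl fun a _ => by ring
  rw [hs]
  linarith

/-- Width bound: two numbers of `[lo, hi]` differ by at most `hi − lo`. [folklore] -/
private theorem abs_sub_le_of_mem_Icc {x y lo hi : ℝ} (hx : x ∈ Set.Icc lo hi) (hy : y ∈ Set.Icc lo hi) :
    |x - y| ≤ hi - lo := by
  rw [abs_sub_le_iff]
  constructor <;> linarith [hx.1, hx.2, hy.1, hy.2]

/-- **Anchor energy of a foreign minimiser, priced by bracket widths.** With brackets
`e_{Ψ_a}(σ) ∈ [lo_a, hi_a]` valid for every `σ ∈ S` (kinematic ranges, or certified class-wide words):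
`e_{Ψ(θ₀)}(ω) ≤ e(θ₀) + Σ_a |θ_a − θ₀_a|·(hi_a − lo_a)` for every minimiser `ω` at any `θ` — the energy
EXCESS BUDGET with which an anchor relaxation must be issued to cover the whole box
`|θ_a − θ₀_a| ≤ r_a`. [cite: WangEtAl2024, §III] -/
theorem meanEnergy_anchor_le_of_isMinOn_of_mem_Icc {ω ω₀ : InfVolFermionState d} (hω : ω ∈ S)
    (hω₀ : ω₀ ∈ S) {θ θ₀ : ι → ℝ}
    (hmin : IsMinOn (fun σ : InfVolFermionState d => σ.meanEnergy (FermionInteraction.linearFamily Ψ₀ Ψ θ) R) S ω)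
    (hmin₀ : IsMinOn (fun σ : InfVolFermionState d => σ.meanEnergy (FermionInteraction.linearFamily Ψ₀ Ψ θ₀) R) S ω₀)
    {lo hi : ι → ℝ} (hB : ∀ σ ∈ S, ∀ a, σ.meanEnergy (Ψ a) R ∈ Set.Icc (lo a) (hi a)) :
    ω.meanEnergy (FermionInteraction.linearFamily Ψ₀ Ψ θ₀) R ≤
      FermionInteraction.infMeanEnergyOn S (FermionInteraction.linearFamily Ψ₀ Ψ θ₀) R +
        ∑ a, |θ a - θ₀ a| * (hi a - lo a) := by
  refine (meanEnergy_anchor_le_of_isMinOn Ψ₀ Ψ R hω₀ hmin hmin₀).trans (add_le_add le_rfl ?_)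
  exact Finset.sum_le_sum fun a _ => by
    calc (θ a - θ₀ a) * (ω₀.meanEnergy (Ψ a) R - ω.meanEnergy (Ψ a) R)
        ≤ |(θ a - θ₀ a) * (ω₀.meanEnergy (Ψ a) R - ω.meanEnergy (Ψ a) R)| := le_abs_self _
      _ = |θ a - θ₀ a| * |ω₀.meanEnergy (Ψ a) R - ω.meanEnergy (Ψ a) R| := abs_mul _ _
      _ ≤ |θ a - θ₀ a| * (hi a - lo a) :=
          mul_le_mul_of_nonneg_left (abs_sub_le_of_mem_Icc (hB ω₀ hω₀ a) (hB ω hω a)) (abs_nonneg _)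

end InfVolFermionState

/-! ### §8. Monotonicity in a coordinate with a signed conjugate density -/

namespace FermionInteraction

variable {S : Set (InfVolFermionState d)} (Ψ₀ : FermionInteraction d) (Ψ : ι → FermionInteraction d)
  (R : ℝ)

/-- **Signed direction ⇒ monotone coordinate.** If the conjugate density of the coordinate `a` is
non-negative on the class (`0 ≤ e_{Ψ_a}(ω)` for all `ω ∈ S`; e.g. `Ψ_a` = on-site repulsion, docc `≥ 0`;
`Ψ_a` = particle number), then `e` is non-decreasing in `θ_a` with the other couplings fixed (the
`t–t'–U` instance is `energyDensityTT'_mono_U`). [cite: Griffiths1966, §II] -/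
theorem infMeanEnergyOn_linearFamily_mono_coordinate {a : ι}
    (hpos : ∀ ω ∈ S, 0 ≤ ω.meanEnergy (Ψ a) R) {θ θ' : ι → ℝ} (hoff : ∀ b, b ≠ a → θ b = θ' b)
    (ha : θ a ≤ θ' a) :
    infMeanEnergyOn S (linearFamily Ψ₀ Ψ θ) R ≤ infMeanEnergyOn S (linearFamily Ψ₀ Ψ θ') R := by
  rcases S.eq_empty_or_nonempty with rfl | hS
  · simp only [infMeanEnergyOn_empty, le_refl]
  refine le_infMeanEnergyOn _ R hS fun ω hω => ?_
  refine (infMeanEnergyOn_le_meanEnergy (linearFamily Ψ₀ Ψ θ) R hω).trans ?_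
  rw [ω.meanEnergy_linearFamily_eq_add_sum_sub_mul Ψ₀ Ψ θ θ' R,
    Finset.sum_eq_single a (fun b _ hb => by rw [hoff b hb, sub_self, zero_mul])
      (fun h => absurd (Finset.mem_univ a) h)]
  nlinarith [hpos ω hω]

end FermionInteraction

/-! ### §9. The density-constrained (canonical) variational density -/

namespace FermionInteraction

/-- **The translation-invariant ground-state energy density AT DENSITY `ρ`**:
`e_ρ(Ψ) = inf { e_Ψ(ω) : ω translation invariant, ρ(ω) = ρ }` — the canonical (fixed-filling)
variational object; for the `t–t'` Hubbard interaction (`U ≥ 0`, `0 < ρ < 2`) it is Ruelle's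
thermodynamic limit `energyDensityTT' t t' U ρ` (`tiGroundEnergyDensityAt_hubbardTTPrime_eq_energyDensityTT'`).
Bratteli–Kishimoto–Robinson (1978) Thm. 2 / Ruelle (1969) §3.4. [cite: Ruelle1969, §3.4] -/
def tiGroundEnergyDensityAt (Ψ : FermionInteraction d) (R ρ : ℝ) : ℝ :=
  infMeanEnergyOn {ω : InfVolFermionState d | ω.IsTranslationInvariant ∧ ω.density = ρ} Ψ R

variable (Ψ₁ : FermionInteraction d) (R : ℝ)

/-- Definitional unfolding. [cite: Ruelle1969, §3.4] -/
theorem tiGroundEnergyDensityAt_eq_infMeanEnergyOn (ρ : ℝ) :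
    Ψ₁.tiGroundEnergyDensityAt R ρ =
      infMeanEnergyOn {ω : InfVolFermionState d | ω.IsTranslationInvariant ∧ ω.density = ρ} Ψ₁ R := rfl

/-- **Variational upper bound at fixed density**: `e_ρ(Ψ) ≤ e_Ψ(ω)` for every translation-invariant `ω`
of density `ρ`. [cite: Ruelle1969, §3.4] -/
theorem tiGroundEnergyDensityAt_le_meanEnergy {ω : InfVolFermionState d} (hω : ω.IsTranslationInvariant)
    {ρ : ℝ} (hρ : ω.density = ρ) : Ψ₁.tiGroundEnergyDensityAt R ρ ≤ ω.meanEnergy Ψ₁ R :=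
  infMeanEnergyOn_le_meanEnergy Ψ₁ R (S := {ω | ω.IsTranslationInvariant ∧ ω.density = ρ}) ⟨hω, hρ⟩

/-- **Greatest lower bound at fixed density** (realised density): a number below `e_Ψ(ω)` for every
translation-invariant `ω` of density `ρ` is `≤ e_ρ(Ψ)`. [cite: Ruelle1969, §3.4] -/
theorem le_tiGroundEnergyDensityAt {ρ : ℝ}
    (hne : ∃ ω : InfVolFermionState d, ω.IsTranslationInvariant ∧ ω.density = ρ) {c : ℝ}
    (h : ∀ ω : InfVolFermionState d, ω.IsTranslationInvariant → ω.density = ρ → c ≤ ω.meanEnergy Ψ₁ R) :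
    c ≤ Ψ₁.tiGroundEnergyDensityAt R ρ :=
  le_infMeanEnergyOn Ψ₁ R (S := {ω | ω.IsTranslationInvariant ∧ ω.density = ρ}) hne
    fun ω hω => h ω hω.1 hω.2

/-- `c ≤ e_ρ(Ψ)` iff `c ≤ e_Ψ(ω)` for every translation-invariant `ω` of density `ρ` (realised density)
— soundness and completeness of certified lower bounds at fixed filling. [cite: Ruelle1969, §3.4] -/
theorem le_tiGroundEnergyDensityAt_iff {ρ : ℝ}
    (hne : ∃ ω : InfVolFermionState d, ω.IsTranslationInvariant ∧ ω.density = ρ) {c : ℝ} :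
    c ≤ Ψ₁.tiGroundEnergyDensityAt R ρ ↔
      ∀ ω : InfVolFermionState d, ω.IsTranslationInvariant → ω.density = ρ → c ≤ ω.meanEnergy Ψ₁ R :=
  ⟨fun h _ hω hρ => h.trans (tiGroundEnergyDensityAt_le_meanEnergy Ψ₁ R hω hρ),
    le_tiGroundEnergyDensityAt Ψ₁ R hne⟩

/-- **The unconstrained density is below every constrained one**: `e₀(Ψ) ≤ e_ρ(Ψ)` for every realised
density `ρ`. [cite: BratteliKishimotoRobinson1978, Thm. 2 (condition 2)] -/
theorem tiGroundEnergyDensity_le_tiGroundEnergyDensityAt {ρ : ℝ}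
    (hne : ∃ ω : InfVolFermionState d, ω.IsTranslationInvariant ∧ ω.density = ρ) :
    Ψ₁.tiGroundEnergyDensity R ≤ Ψ₁.tiGroundEnergyDensityAt R ρ :=
  infMeanEnergyOn_anti Ψ₁ R (S := {ω | ω.IsTranslationInvariant ∧ ω.density = ρ}) hne fun _ hω => hω.1

/-- **CONVEXITY IN THE DENSITY, three-point form.** For realised densities `ρ₁, ρ₂` and
`a, b ≥ 0`, `a + b = 1`: `e_{aρ₁+bρ₂}(Ψ) ≤ a e_{ρ₁}(Ψ) + b e_{ρ₂}(Ψ)` — mix near-minimisers (the state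
space is convex; density and mean energy are affine, `density_mix`, `meanEnergy_mix`). Ruelle (1969)
§3.4 (convexity of the canonical energy density in the particle density). [cite: Ruelle1969, §3.4] -/
theorem tiGroundEnergyDensityAt_convex_comb_le {ρ₁ ρ₂ : ℝ}
    (h₁ : ∃ ω : InfVolFermionState d, ω.IsTranslationInvariant ∧ ω.density = ρ₁)
    (h₂ : ∃ ω : InfVolFermionState d, ω.IsTranslationInvariant ∧ ω.density = ρ₂)
    {a b : ℝ} (ha : 0 ≤ a) (hb : 0 ≤ b) (hab : a + b = 1) :
    Ψ₁.tiGroundEnergyDensityAt R (a * ρ₁ + b * ρ₂) ≤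
      a * Ψ₁.tiGroundEnergyDensityAt R ρ₁ + b * Ψ₁.tiGroundEnergyDensityAt R ρ₂ := by
  refine le_of_forall_pos_le_add fun ε hε => ?_
  obtain ⟨ω₁, ⟨hω₁, hρ₁⟩, he₁⟩ := exists_meanEnergy_lt_of_infMeanEnergyOn_lt Ψ₁ R
    (S := {ω | ω.IsTranslationInvariant ∧ ω.density = ρ₁}) h₁
    (lt_add_of_pos_right (Ψ₁.tiGroundEnergyDensityAt R ρ₁) hε)
  obtain ⟨ω₂, ⟨hω₂, hρ₂⟩, he₂⟩ := exists_meanEnergy_lt_of_infMeanEnergyOn_lt Ψ₁ R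
    (S := {ω | ω.IsTranslationInvariant ∧ ω.density = ρ₂}) h₂
    (lt_add_of_pos_right (Ψ₁.tiGroundEnergyDensityAt R ρ₂) hε)
  have ha1 : a ≤ 1 := by linarith
  have hmixTI := InfVolFermionState.IsTranslationInvariant.mix hω₁ hω₂ a ha ha1
  have hmixρ : (InfVolFermionState.mix a ha ha1 ω₁ ω₂).density = a * ρ₁ + b * ρ₂ := by
    rw [InfVolFermionState.density_mix, hρ₁, hρ₂, show 1 - a = b by linarith]
  have hle := tiGroundEnergyDensityAt_le_meanEnergy Ψ₁ R hmixTI hmixρ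
  rw [InfVolFermionState.meanEnergy_mix, show 1 - a = b by linarith] at hle
  change _ ≤ a * Ψ₁.tiGroundEnergyDensityAt R ρ₁ + b * Ψ₁.tiGroundEnergyDensityAt R ρ₂ + ε
  nlinarith [mul_le_mul_of_nonneg_left he₁.le ha, mul_le_mul_of_nonneg_left he₂.le hb]

/-- **CONVEXITY IN THE DENSITY.** On every convex set `D` of realised densities, `ρ ↦ e_ρ(Ψ)` is
convex (the `t–t'–U` instance is the tree's `convexOn_energyDensityTT'`). [cite: Ruelle1969, §3.4] -/
theorem convexOn_tiGroundEnergyDensityAt {D : Set ℝ} (hD : Convex ℝ D)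
    (hne : ∀ ρ ∈ D, ∃ ω : InfVolFermionState d, ω.IsTranslationInvariant ∧ ω.density = ρ) :
    ConvexOn ℝ D (Ψ₁.tiGroundEnergyDensityAt R) := by
  refine ⟨hD, fun x hx y hy a b ha hb hab => ?_⟩
  simp only [smul_eq_mul]
  exact tiGroundEnergyDensityAt_convex_comb_le Ψ₁ R (hne x hx) (hne y hy) ha hb hab

/-- **LEGENDRE LINK, sheet form**: for the `μ`-pencil `Ψ − μ·n` (`n = numberInteraction d`, the
companion file's `pencil Ψ n (−μ)`) and every realised density `ρ`:
`e₀(Ψ − μn) + μρ ≤ e_ρ(Ψ)` — a certified lower bound on the grand-potential density is an affine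
FLOOR ("`μ`-sheet") under the canonical density at EVERY filling (model-free form of
`HubbardTTPrimeChemicalPotentialFloors` / `gcEnergyDensityTT'_add_mul_le`).
[cite: Ruelle1969, §3.4] -/
theorem tiGroundEnergyDensity_pencil_number_add_mul_le (μ : ℝ) {ρ : ℝ}
    (hne : ∃ ω : InfVolFermionState d, ω.IsTranslationInvariant ∧ ω.density = ρ) :
    (pencil Ψ₁ (numberInteraction d) (-μ)).tiGroundEnergyDensity R + μ * ρ ≤
      Ψ₁.tiGroundEnergyDensityAt R ρ := by
  refine le_tiGroundEnergyDensityAt Ψ₁ R hne fun ω hω hρ => ?_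
  have h := (pencil Ψ₁ (numberInteraction d) (-μ)).tiGroundEnergyDensity_le_meanEnergy R hω
  rw [ω.meanEnergy_pencil, ω.meanEnergy_numberInteraction, hρ] at h
  linarith

/-- **LEGENDRE LINK, floor form**: sheets at every realised density recombine into a grand-potential
floor — if `c + μρ ≤ e_ρ(Ψ)` for every realised `ρ`, then `c ≤ e₀(Ψ − μn)`. [cite: Ruelle1969, §3.4] -/
theorem le_tiGroundEnergyDensity_pencil_number (μ : ℝ) {c : ℝ}
    (h : ∀ ρ : ℝ, (∃ ω : InfVolFermionState d, ω.IsTranslationInvariant ∧ ω.density = ρ) →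
      c + μ * ρ ≤ Ψ₁.tiGroundEnergyDensityAt R ρ) :
    c ≤ (pencil Ψ₁ (numberInteraction d) (-μ)).tiGroundEnergyDensity R := by
  refine (pencil Ψ₁ (numberInteraction d) (-μ)).le_tiGroundEnergyDensity R fun ω hω => ?_
  rw [ω.meanEnergy_pencil, ω.meanEnergy_numberInteraction]
  have h1 := h ω.density ⟨ω, hω, rfl⟩
  have h2 := tiGroundEnergyDensityAt_le_meanEnergy Ψ₁ R hω rfl
  linarith

/-- **LEGENDRE LINK**: `e₀(Ψ − μn)` is the greatest lower bound of `{e_ρ(Ψ) − μρ : ρ realised}` —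
the grand-potential density is the concave conjugate of the canonical density
(`e₀(Ψ − μn) = inf_ρ (e_ρ(Ψ) − μρ)`; Fenchel–Legendre duality of the two ensembles, model-free).
[cite: Ruelle1969, §3.4] -/
theorem isGLB_tiGroundEnergyDensity_sub_mul (μ : ℝ) :
    IsGLB {x : ℝ | ∃ ρ : ℝ, (∃ ω : InfVolFermionState d, ω.IsTranslationInvariant ∧ ω.density = ρ) ∧
        x = Ψ₁.tiGroundEnergyDensityAt R ρ - μ * ρ}
      ((pencil Ψ₁ (numberInteraction d) (-μ)).tiGroundEnergyDensity R) := by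
  refine ⟨?_, fun c hc => ?_⟩
  · rintro x ⟨ρ, hne, rfl⟩
    linarith [tiGroundEnergyDensity_pencil_number_add_mul_le Ψ₁ R μ hne]
  · refine le_tiGroundEnergyDensity_pencil_number Ψ₁ R μ fun ρ hne => ?_
    have := hc ⟨ρ, hne, rfl⟩
    linarith

end FermionInteraction

/-! ### §9b. The two standard classes by name -/

namespace FermionInteraction

variable (Ψ₀ : FermionInteraction d) (Ψ : ι → FermionInteraction d) (R : ℝ)

/-- **Joint concavity of the translation-invariant ground-state energy density in the coupling
vector** (`S` = translation-invariant states): `θ ↦ e₀(Ψ₀ + Σθ_aΨ_a)` is concave on `ι → ℝ` — the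
multi-parameter form of `concaveOn_tiGroundEnergyDensity_pencil`. [cite: Israel1979, Thm. I.3.4] -/
theorem concaveOn_tiGroundEnergyDensity_linearFamily :
    ConcaveOn ℝ Set.univ fun θ : ι → ℝ => (linearFamily Ψ₀ Ψ θ).tiGroundEnergyDensity R :=
  concaveOn_infMeanEnergyOn_linearFamily _ Ψ₀ Ψ R

/-- **Joint concavity at fixed density**: for every `ρ`, `θ ↦ e_ρ(Ψ₀ + Σθ_aΨ_a)` is concave on
`ι → ℝ` (the multi-coupling, model-free form of the tree's `concaveOn` rows for `energyDensityTT'` in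
`(t, t', U)`). [cite: Israel1979, Thm. I.3.4] -/
theorem concaveOn_tiGroundEnergyDensityAt_linearFamily (ρ : ℝ) :
    ConcaveOn ℝ Set.univ fun θ : ι → ℝ => (linearFamily Ψ₀ Ψ θ).tiGroundEnergyDensityAt R ρ :=
  concaveOn_infMeanEnergyOn_linearFamily _ Ψ₀ Ψ R

/-- **BOX ⇒ WORD at fixed density**: a floor certified at the `2^|ι|` vertices of a coupling box holds
at every coupling vector of the box, at the same filling `ρ`. [cite: Rockafellar1970, Thm 32.2] -/
theorem le_tiGroundEnergyDensityAt_linearFamily_of_mem_Icc [DecidableEq ι] (ρ : ℝ) (lo hi : ι → ℝ)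
    {m : ℝ} (hm : ∀ v ∈ Fintype.piFinset (fun a => ({lo a, hi a} : Finset ℝ)),
      m ≤ (linearFamily Ψ₀ Ψ v).tiGroundEnergyDensityAt R ρ)
    {θ : ι → ℝ} (hθ : θ ∈ Set.Icc lo hi) : m ≤ (linearFamily Ψ₀ Ψ θ).tiGroundEnergyDensityAt R ρ :=
  le_infMeanEnergyOn_linearFamily_of_mem_Icc _ Ψ₀ Ψ R lo hi hm hθ

/-- **BOX ⇒ WORD for the translation-invariant class** (grand-canonical-type object, e.g. with a
`−μn` direction among the `Ψ_a`). [cite: Rockafellar1970, Thm 32.2] -/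
theorem le_tiGroundEnergyDensity_linearFamily_of_mem_Icc [DecidableEq ι] (lo hi : ι → ℝ)
    {m : ℝ} (hm : ∀ v ∈ Fintype.piFinset (fun a => ({lo a, hi a} : Finset ℝ)),
      m ≤ (linearFamily Ψ₀ Ψ v).tiGroundEnergyDensity R)
    {θ : ι → ℝ} (hθ : θ ∈ Set.Icc lo hi) : m ≤ (linearFamily Ψ₀ Ψ θ).tiGroundEnergyDensity R :=
  le_infMeanEnergyOn_linearFamily_of_mem_Icc _ Ψ₀ Ψ R lo hi hm hθ

open scoped Matrix.Norms.L2Operator in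
/-- **Joint Lipschitz bound at fixed density, direction norms**:
`|e_ρ(Ψ(θ)) − e_ρ(Ψ(θ'))| ≤ Σ_a ‖E_{Ψ_a}‖ |θ_a − θ'_a|`. [cite: Israel1979, Thm. I.3.4] -/
theorem abs_tiGroundEnergyDensityAt_linearFamily_sub_le_norm (ρ : ℝ) (θ θ' : ι → ℝ) :
    |(linearFamily Ψ₀ Ψ θ).tiGroundEnergyDensityAt R ρ - (linearFamily Ψ₀ Ψ θ').tiGroundEnergyDensityAt R ρ| ≤
      ∑ a, ‖(Ψ a).meanEnergyObs R‖ * |θ a - θ' a| :=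
  abs_infMeanEnergyOn_linearFamily_sub_le_norm Ψ₀ Ψ R _ θ θ'

/-- **Multi-slope tangent plane at a fixed-density minimiser**: if `ω₀` is translation invariant of
density `ρ` with `e_{Ψ(θ₀)}(ω₀) = e_ρ(Ψ(θ₀))` (a canonical ground state at the anchor, e.g. a torus-limit
ground state of the `t–t'` model), then `e_ρ(Ψ(θ)) ≤ e_ρ(Ψ(θ₀)) + Σ_a (θ_a − θ₀_a) e_{Ψ_a}(ω₀)` for all
`θ`. [cite: Griffiths1966, §II] -/
theorem tiGroundEnergyDensityAt_linearFamily_le_tangent {ω₀ : InfVolFermionState d}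
    (hω₀ : ω₀.IsTranslationInvariant) {ρ : ℝ} (hρ : ω₀.density = ρ) {θ₀ : ι → ℝ}
    (hmin : ω₀.meanEnergy (linearFamily Ψ₀ Ψ θ₀) R ≤ (linearFamily Ψ₀ Ψ θ₀).tiGroundEnergyDensityAt R ρ)
    (θ : ι → ℝ) :
    (linearFamily Ψ₀ Ψ θ).tiGroundEnergyDensityAt R ρ ≤
      (linearFamily Ψ₀ Ψ θ₀).tiGroundEnergyDensityAt R ρ + ∑ a, (θ a - θ₀ a) * ω₀.meanEnergy (Ψ a) R :=
  infMeanEnergyOn_linearFamily_le_tangent Ψ₀ Ψ R (S := {ω | ω.IsTranslationInvariant ∧ ω.density = ρ})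
    ⟨hω₀, hρ⟩ ((isMinOn_meanEnergy_iff _ R (S := {ω | ω.IsTranslationInvariant ∧ ω.density = ρ})
      ⟨hω₀, hρ⟩).2 hmin) θ

end FermionInteraction

/-! ### §10. The `t–t'` Hubbard bridge -/

section TTPrime

/-- The three coupling directions of the `t–t'–U` family: `Φ(1,0,0)` (nearest-neighbour hopping),
`Φ(0,1,0)` (diagonal hopping), `Φ(0,0,1)` (on-site repulsion). [cite: XuEtAl2024, eq. (1)] -/
def hubbardTTPrimeDirections : Fin 3 → FermionInteraction 2 :=
  ![hubbardTTPrimeFermionInteraction 1 0 0, hubbardTTPrimeFermionInteraction 0 1 0,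
    hubbardTTPrimeFermionInteraction 0 0 1]

/-- **The `t–t'–U` interaction IS the linear family** with base `Φ(0,0,0) = 0` and directions
`Φ(1,0,0), Φ(0,1,0), Φ(0,0,1)`: `Φ(θ₀, θ₁, θ₂) = linearFamily Φ(0,0,0) (Φ(1,0,0), Φ(0,1,0), Φ(0,0,1)) θ`
— so §3–§9 apply to the tree's `t–t'` objects with `θ = (t, t', U)`. [cite: XuEtAl2024, eq. (1)] -/
theorem hubbardTTPrimeFermionInteraction_eq_linearFamily (θ : Fin 3 → ℝ) :
    hubbardTTPrimeFermionInteraction (θ 0) (θ 1) (θ 2) =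
      FermionInteraction.linearFamily (hubbardTTPrimeFermionInteraction 0 0 0) hubbardTTPrimeDirections θ := by
  refine FermionInteraction.ext fun X => ?_
  rw [FermionInteraction.linearFamily_apply, Fin.sum_univ_three]
  simp only [hubbardTTPrimeDirections, Matrix.cons_val_zero, Matrix.cons_val_one, Matrix.head_cons,
    Matrix.cons_val_two, Matrix.tail_cons]
  have h0 : (hubbardTTPrimeFermionInteraction 0 0 0).Φ X = 0 := by
    have h := hubbardTTPrimeFermionInteraction_smul 0 0 0 0 X
    rwa [mul_zero, Complex.ofReal_zero, zero_smul] at h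
  have h1 := hubbardTTPrimeFermionInteraction_smul (θ 0) 1 0 0 X
  have h2 := hubbardTTPrimeFermionInteraction_smul (θ 1) 0 1 0 X
  have h3 := hubbardTTPrimeFermionInteraction_smul (θ 2) 0 0 1 X
  rw [mul_one, mul_zero] at h1 h2 h3
  rw [h0, zero_add, ← h1, ← h2, ← h3, ← hubbardTTPrimeFermionInteraction_add,
    ← hubbardTTPrimeFermionInteraction_add]
  simp only [add_zero, zero_add]

/-- **Realised densities on `ℤ²`**: every `ρ ∈ (0, 2)` is the density of a translation-invariant state
(a torus-limit ground state of the `t–t'` model, `isLeast_meanEnergy_energyDensityTT'`). [cite: Ruelle1969, §3.4] -/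
theorem exists_isTranslationInvariant_density_eq {ρ : ℝ} (hρ0 : 0 < ρ) (hρ2 : ρ < 2) :
    ∃ ω : InfVolFermionState 2, ω.IsTranslationInvariant ∧ ω.density = ρ := by
  obtain ⟨ω, hω, hρ, -⟩ := (InfVolFermionState.isLeast_meanEnergy_energyDensityTT' 0 0 le_rfl hρ0 hρ2).1
  exact ⟨ω, hω, hρ⟩

/-- **BRIDGE: the density-constrained variational density of the `t–t'` interaction is Ruelle's
thermodynamic limit**: for `U ≥ 0` and `0 < ρ < 2`,
`tiGroundEnergyDensityAt Φ(t,t',U) 1 ρ = energyDensityTT' t t' U ρ` (the tree's variational principle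
`isLeast_meanEnergy_energyDensityTT'`). [cite: BratteliKishimotoRobinson1978, Thm. 2] -/
theorem tiGroundEnergyDensityAt_hubbardTTPrime_eq_energyDensityTT' (t t' : ℝ) {U : ℝ} (hU : 0 ≤ U)
    {ρ : ℝ} (hρ0 : 0 < ρ) (hρ2 : ρ < 2) :
    (hubbardTTPrimeFermionInteraction t t' U).tiGroundEnergyDensityAt 1 ρ = energyDensityTT' t t' U ρ := by
  have hL := InfVolFermionState.isLeast_meanEnergy_energyDensityTT' t t' hU hρ0 hρ2
  have hset : ((fun ω : InfVolFermionState 2 => ω.meanEnergy (hubbardTTPrimeFermionInteraction t t' U) 1) ''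
      {ω : InfVolFermionState 2 | ω.IsTranslationInvariant ∧ ω.density = ρ}) =
      {e : ℝ | ∃ ω : InfVolFermionState 2, ω.IsTranslationInvariant ∧ ω.density = ρ ∧
        ω.meanEnergy (hubbardTTPrimeFermionInteraction t t' U) 1 = e} := by
    ext e
    simp only [Set.mem_image, Set.mem_setOf_eq, and_assoc]
  rw [FermionInteraction.tiGroundEnergyDensityAt, FermionInteraction.infMeanEnergyOn, hset]
  exact hL.csInf_eq

/-- **Corollary (sanity bridge)**: the box ⇒ word rule of §3 for the `t–t'–U` coordinates reads, through
the bridge, on `energyDensityTT'`: a floor `m` certified at the eight vertices of a coupling box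
`[lo, hi] ⊆ ℝ³` (`lo 2 ≥ 0`, i.e. `U ≥ 0` on the box) holds at every `(t, t', U)` of the box, at every
filling `0 < ρ < 2`. [cite: Israel1979, Thm. I.3.4] -/
theorem energyDensityTT'_ge_of_boxVertices (lo hi : Fin 3 → ℝ) (hlo : 0 ≤ lo 2) {ρ : ℝ} (hρ0 : 0 < ρ)
    (hρ2 : ρ < 2) {m : ℝ}
    (hm : ∀ v ∈ Fintype.piFinset (fun a => ({lo a, hi a} : Finset ℝ)),
      m ≤ energyDensityTT' (v 0) (v 1) (v 2) ρ)
    {θ : Fin 3 → ℝ} (hθ : θ ∈ Set.Icc lo hi) : m ≤ energyDensityTT' (θ 0) (θ 1) (θ 2) ρ := by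
  have hv2 : ∀ v ∈ Fintype.piFinset (fun a => ({lo a, hi a} : Finset ℝ)), 0 ≤ v 2 := by
    intro v hv
    have h2 := Fintype.mem_piFinset.1 hv 2
    rcases Finset.mem_insert.1 h2 with h | h
    · rw [h]; exact hlo
    · rw [Finset.mem_singleton.1 h]; exact hlo.trans ((hθ.1 2).trans (hθ.2 2))
  rw [← tiGroundEnergyDensityAt_hubbardTTPrime_eq_energyDensityTT' _ _ (hlo.trans (hθ.1 2)) hρ0 hρ2,
    hubbardTTPrimeFermionInteraction_eq_linearFamily, FermionInteraction.tiGroundEnergyDensityAt]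
  refine FermionInteraction.le_infMeanEnergyOn_linearFamily_of_mem_Icc _ _ _ _ lo hi (fun v hv => ?_) hθ
  rw [← hubbardTTPrimeFermionInteraction_eq_linearFamily,
    ← FermionInteraction.tiGroundEnergyDensityAt,
    tiGroundEnergyDensityAt_hubbardTTPrime_eq_energyDensityTT' _ _ (hv2 v hv) hρ0 hρ2]
  exact hm v hv

end TTPrime

/-! ### §11. One anchor covers the box: minimiser transport without an anchor minimiser,
energy-window words, and certified brackets on every conjugate density from anchor-line data -/

namespace InfVolFermionState

variable {S : Set (InfVolFermionState d)} (Ψ₀ : FermionInteraction d) (Ψ : ι → FermionInteraction d)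
  (R : ℝ)

/-- **Minimiser transport, priced, with NO minimiser needed at the anchor.** If `ω ∈ S` minimises
`e_{Ψ(θ)}` on `S` and the conjugate densities are bracketed class-wide, `e_{Ψ_a}(σ) ∈ [lo_a, hi_a]` for
all `σ ∈ S`, then `e_{Ψ(θ₀)}(ω) ≤ e(θ₀) + Σ_a |θ_a − θ₀_a|(hi_a − lo_a)` (`e(θ₀) = inf_S e_{Ψ(θ₀)}`;
compare with near-minimisers at `θ₀`). [cite: WangEtAl2024, §III] -/
theorem meanEnergy_anchor_le_excess_of_isMinOn {ω : InfVolFermionState d} (hω : ω ∈ S) {θ : ι → ℝ}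
    (hmin : IsMinOn (fun σ : InfVolFermionState d =>
      σ.meanEnergy (FermionInteraction.linearFamily Ψ₀ Ψ θ) R) S ω)
    {lo hi : ι → ℝ} (hB : ∀ σ ∈ S, ∀ a, σ.meanEnergy (Ψ a) R ∈ Set.Icc (lo a) (hi a)) (θ₀ : ι → ℝ) :
    ω.meanEnergy (FermionInteraction.linearFamily Ψ₀ Ψ θ₀) R ≤
      FermionInteraction.infMeanEnergyOn S (FermionInteraction.linearFamily Ψ₀ Ψ θ₀) R +
        ∑ a, |θ a - θ₀ a| * (hi a - lo a) := by
  refine le_of_forall_pos_le_add fun η hη => ?_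
  obtain ⟨σ, hσ, hlt⟩ := FermionInteraction.exists_meanEnergy_lt_of_infMeanEnergyOn_lt
    (FermionInteraction.linearFamily Ψ₀ Ψ θ₀) R ⟨ω, hω⟩
    (lt_add_of_pos_right
      (FermionInteraction.infMeanEnergyOn S (FermionInteraction.linearFamily Ψ₀ Ψ θ₀) R) hη)
  have h1 : ω.meanEnergy (FermionInteraction.linearFamily Ψ₀ Ψ θ) R ≤
      σ.meanEnergy (FermionInteraction.linearFamily Ψ₀ Ψ θ) R := hmin hσ
  rw [ω.meanEnergy_linearFamily_eq_add_sum_sub_mul Ψ₀ Ψ θ θ₀ R,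
    σ.meanEnergy_linearFamily_eq_add_sum_sub_mul Ψ₀ Ψ θ θ₀ R] at h1
  have h2 : ∑ a, (θ a - θ₀ a) * σ.meanEnergy (Ψ a) R - ∑ a, (θ a - θ₀ a) * ω.meanEnergy (Ψ a) R ≤
      ∑ a, |θ a - θ₀ a| * (hi a - lo a) := by
    rw [← Finset.sum_sub_distrib]
    exact Finset.sum_le_sum fun a _ => by
      calc (θ a - θ₀ a) * σ.meanEnergy (Ψ a) R - (θ a - θ₀ a) * ω.meanEnergy (Ψ a) R
          = (θ a - θ₀ a) * (σ.meanEnergy (Ψ a) R - ω.meanEnergy (Ψ a) R) := by ring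
        _ ≤ |(θ a - θ₀ a) * (σ.meanEnergy (Ψ a) R - ω.meanEnergy (Ψ a) R)| := le_abs_self _
        _ = |θ a - θ₀ a| * |σ.meanEnergy (Ψ a) R - ω.meanEnergy (Ψ a) R| := abs_mul _ _
        _ ≤ |θ a - θ₀ a| * (hi a - lo a) :=
            mul_le_mul_of_nonneg_left (abs_sub_le_of_mem_Icc (hB σ hσ a) (hB ω hω a)) (abs_nonneg _)
  linarith

/-- **AN ENERGY-WINDOW WORD AT ONE ANCHOR COVERS THE BOX.** Suppose a word `P` is certified at the
anchor `θ₀` for every state of the class inside the energy window of excess `ε` above the ground-state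
energy density (`∀ σ ∈ S, e_{Ψ(θ₀)}(σ) ≤ e(θ₀) + ε → P σ` — the output of an energy-constrained
relaxation, Wang et al. 2024 §III), and the conjugate densities are bracketed class-wide by
`[lo_a, hi_a]`. Then `P` holds for every class minimiser at every coupling vector `θ` with
`Σ_a |θ_a − θ₀_a|(hi_a − lo_a) ≤ ε` — e.g. on the whole box `|θ_a − θ₀_a| ≤ r_a` once
`Σ_a r_a(hi_a − lo_a) ≤ ε`. [cite: WangEtAl2024, §III] -/
theorem of_energyWindow_word_of_isMinOn {P : InfVolFermionState d → Prop} {θ₀ : ι → ℝ} {ε : ℝ}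
    (hword : ∀ σ ∈ S, σ.meanEnergy (FermionInteraction.linearFamily Ψ₀ Ψ θ₀) R ≤
      FermionInteraction.infMeanEnergyOn S (FermionInteraction.linearFamily Ψ₀ Ψ θ₀) R + ε → P σ)
    {lo hi : ι → ℝ} (hB : ∀ σ ∈ S, ∀ a, σ.meanEnergy (Ψ a) R ∈ Set.Icc (lo a) (hi a))
    {θ : ι → ℝ} (hθ : ∑ a, |θ a - θ₀ a| * (hi a - lo a) ≤ ε)
    {ω : InfVolFermionState d} (hω : ω ∈ S)
    (hmin : IsMinOn (fun σ : InfVolFermionState d =>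
      σ.meanEnergy (FermionInteraction.linearFamily Ψ₀ Ψ θ) R) S ω) : P ω :=
  hword ω hω ((meanEnergy_anchor_le_excess_of_isMinOn Ψ₀ Ψ R hω hmin hB θ₀).trans (by linarith))

/-- **Box form**: radii `r_a` with `Σ_a r_a(hi_a − lo_a) ≤ ε` ⇒ the anchor word holds for every class
minimiser at every `θ` of the box `|θ_a − θ₀_a| ≤ r_a`. [cite: WangEtAl2024, §III] -/
theorem of_energyWindow_word_of_isMinOn_of_abs_sub_le {P : InfVolFermionState d → Prop} {θ₀ : ι → ℝ}
    {ε : ℝ}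
    (hword : ∀ σ ∈ S, σ.meanEnergy (FermionInteraction.linearFamily Ψ₀ Ψ θ₀) R ≤
      FermionInteraction.infMeanEnergyOn S (FermionInteraction.linearFamily Ψ₀ Ψ θ₀) R + ε → P σ)
    {lo hi : ι → ℝ} (hB : ∀ σ ∈ S, ∀ a, σ.meanEnergy (Ψ a) R ∈ Set.Icc (lo a) (hi a))
    {r : ι → ℝ} (hr : ∑ a, r a * (hi a - lo a) ≤ ε) {θ : ι → ℝ} (hθ : ∀ a, |θ a - θ₀ a| ≤ r a)
    {ω : InfVolFermionState d} (hω : ω ∈ S)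
    (hmin : IsMinOn (fun σ : InfVolFermionState d =>
      σ.meanEnergy (FermionInteraction.linearFamily Ψ₀ Ψ θ) R) S ω) : P ω := by
  refine of_energyWindow_word_of_isMinOn Ψ₀ Ψ R hword hB (le_trans ?_ hr) hω hmin
  exact Finset.sum_le_sum fun a _ =>
    mul_le_mul_of_nonneg_right (hθ a) (by linarith [(hB ω hω a).1, (hB ω hω a).2])

/-- The mean energy one coordinate step away: `e_{Ψ(θ₀ + δe_a)}(ω) = e_{Ψ(θ₀)}(ω) + δ e_{Ψ_a}(ω)`.
[cite: KomaTasaki1994, §1] -/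
theorem meanEnergy_linearFamily_add_single [DecidableEq ι] (ω : InfVolFermionState d) (θ₀ : ι → ℝ)
    (a : ι) (δ : ℝ) :
    ω.meanEnergy (FermionInteraction.linearFamily Ψ₀ Ψ (θ₀ + Pi.single a δ)) R =
      ω.meanEnergy (FermionInteraction.linearFamily Ψ₀ Ψ θ₀) R + δ * ω.meanEnergy (Ψ a) R := by
  rw [FermionInteraction.linearFamily_add_single, meanEnergy_pencil]

/-- **CERTIFIED FLOOR ON A CONJUGATE DENSITY over the box, from anchor-line data** (multi-coupling
Griffiths / Hellmann–Feynman bracket). Data: a cap `e(θ₀) ≤ u` on the anchor ground-state energy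
density (e.g. variational), a floor `loP ≤ e_{Ψ(θ₀ + δe_a)}(σ)` valid for every `σ ∈ S` (a certified
lower bound at the neighbouring coupling, `δ > 0`), and class-wide brackets `[lo_b, hi_b]` on the
conjugate densities. Then every class minimiser `ω` at ANY `θ` obeys
`(loP − u − Σ_b |θ_b − θ₀_b|(hi_b − lo_b))/δ ≤ e_{Ψ_a}(ω)` — e.g. a floor on the double occupancy /
kinetic energy / density / induced order parameter of every ground state in a coupling box from three
numbers on the anchor line. [cite: Griffiths1966, §II] -/
theorem div_le_meanEnergy_of_anchor_data [DecidableEq ι] {ω : InfVolFermionState d} (hω : ω ∈ S)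
    {θ θ₀ : ι → ℝ}
    (hmin : IsMinOn (fun σ : InfVolFermionState d =>
      σ.meanEnergy (FermionInteraction.linearFamily Ψ₀ Ψ θ) R) S ω)
    {lo hi : ι → ℝ} (hB : ∀ σ ∈ S, ∀ a, σ.meanEnergy (Ψ a) R ∈ Set.Icc (lo a) (hi a))
    {u : ℝ} (hu : FermionInteraction.infMeanEnergyOn S (FermionInteraction.linearFamily Ψ₀ Ψ θ₀) R ≤ u)
    (a : ι) {δ : ℝ} (hδ : 0 < δ) {loP : ℝ}
    (hloP : ∀ σ ∈ S, loP ≤ σ.meanEnergy (FermionInteraction.linearFamily Ψ₀ Ψ (θ₀ + Pi.single a δ)) R) :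
    (loP - u - ∑ b, |θ b - θ₀ b| * (hi b - lo b)) / δ ≤ ω.meanEnergy (Ψ a) R := by
  have h1 := meanEnergy_anchor_le_excess_of_isMinOn Ψ₀ Ψ R hω hmin hB θ₀
  have h2 := hloP ω hω
  rw [meanEnergy_linearFamily_add_single] at h2
  rw [div_le_iff₀ hδ]
  nlinarith

/-- **CERTIFIED CAP ON A CONJUGATE DENSITY over the box, from anchor-line data**: with a floor
`loM ≤ e_{Ψ(θ₀ − δe_a)}(σ)` for all `σ ∈ S` on the OTHER side of the anchor,
`e_{Ψ_a}(ω) ≤ (u + Σ_b |θ_b − θ₀_b|(hi_b − lo_b) − loM)/δ` for every class minimiser `ω` at any `θ`.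
[cite: Griffiths1966, §II] -/
theorem meanEnergy_le_div_of_anchor_data [DecidableEq ι] {ω : InfVolFermionState d} (hω : ω ∈ S)
    {θ θ₀ : ι → ℝ}
    (hmin : IsMinOn (fun σ : InfVolFermionState d =>
      σ.meanEnergy (FermionInteraction.linearFamily Ψ₀ Ψ θ) R) S ω)
    {lo hi : ι → ℝ} (hB : ∀ σ ∈ S, ∀ a, σ.meanEnergy (Ψ a) R ∈ Set.Icc (lo a) (hi a))
    {u : ℝ} (hu : FermionInteraction.infMeanEnergyOn S (FermionInteraction.linearFamily Ψ₀ Ψ θ₀) R ≤ u)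
    (a : ι) {δ : ℝ} (hδ : 0 < δ) {loM : ℝ}
    (hloM : ∀ σ ∈ S, loM ≤ σ.meanEnergy (FermionInteraction.linearFamily Ψ₀ Ψ (θ₀ + Pi.single a (-δ))) R) :
    ω.meanEnergy (Ψ a) R ≤ (u + ∑ b, |θ b - θ₀ b| * (hi b - lo b) - loM) / δ := by
  have h1 := meanEnergy_anchor_le_excess_of_isMinOn Ψ₀ Ψ R hω hmin hB θ₀
  have h2 := hloM ω hω
  rw [meanEnergy_linearFamily_add_single] at h2
  rw [le_div_iff₀ hδ]
  nlinarith

/-- **Two-sided certified window on a conjugate density over the box** (both neighbours of the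
anchor): `e_{Ψ_a}(ω) ∈ [(loP − u − ε)/δ, (u + ε − loM)/δ]`, `ε = Σ_b |θ_b − θ₀_b|(hi_b − lo_b)`, for
every class minimiser `ω` at any `θ`. [cite: Griffiths1966, §II] -/
theorem meanEnergy_mem_Icc_of_anchor_data [DecidableEq ι] {ω : InfVolFermionState d} (hω : ω ∈ S)
    {θ θ₀ : ι → ℝ}
    (hmin : IsMinOn (fun σ : InfVolFermionState d =>
      σ.meanEnergy (FermionInteraction.linearFamily Ψ₀ Ψ θ) R) S ω)
    {lo hi : ι → ℝ} (hB : ∀ σ ∈ S, ∀ a, σ.meanEnergy (Ψ a) R ∈ Set.Icc (lo a) (hi a))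
    {u : ℝ} (hu : FermionInteraction.infMeanEnergyOn S (FermionInteraction.linearFamily Ψ₀ Ψ θ₀) R ≤ u)
    (a : ι) {δ : ℝ} (hδ : 0 < δ) {loP loM : ℝ}
    (hloP : ∀ σ ∈ S, loP ≤ σ.meanEnergy (FermionInteraction.linearFamily Ψ₀ Ψ (θ₀ + Pi.single a δ)) R)
    (hloM : ∀ σ ∈ S, loM ≤ σ.meanEnergy (FermionInteraction.linearFamily Ψ₀ Ψ (θ₀ + Pi.single a (-δ))) R) :
    ω.meanEnergy (Ψ a) R ∈
      Set.Icc ((loP - u - ∑ b, |θ b - θ₀ b| * (hi b - lo b)) / δ)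
        ((u + ∑ b, |θ b - θ₀ b| * (hi b - lo b) - loM) / δ) :=
  ⟨div_le_meanEnergy_of_anchor_data Ψ₀ Ψ R hω hmin hB hu a hδ hloP,
    meanEnergy_le_div_of_anchor_data Ψ₀ Ψ R hω hmin hB hu a hδ hloM⟩

end InfVolFermionState

end Literature.MathematicalPhysics.QuantumLattice

end
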